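import Literature.Analysis.FluidPDE.TorusStrainSubspaceFourier
import Literature.Analysis.FluidPDE.TorusStrainVorticityIsometry
import Literature.Analysis.FluidPDE.TorusNSStrainEquationProjected
import HarnessLib

/-!
# Miller–Sawyer's Helmholtz-type decomposition of symmetric matrix fields on the flat torus:
# the size, the kernel and the divergence of Miller's strain projection `P_{st}`, and the
# fixed-axis `¾`-bound for axial compression with planar stretching

Analysis/FluidPDE support file (theorems only, fully proved; no definitions, no named facts).
Search for candidate a priori estimates; no regularity claim.

E. Miller and E. Sawyer (Trans. Amer. Math. Soc. Ser. B 10 (2023) 1449–1493 = arXiv:2111.12891)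
decompose the space of square-integrable symmetric matrix fields on `ℝ³` (and on `ℝ^d`, `d ≥ 2`,
§5) orthogonally as `L² = L²_{st} ⊕ L²_{Hess} ⊕ L²_{divfree}` (Thm 1.3 = Thm 2.3): strains
`∇_{sym}u`, `∇·u = 0` — Miller's constraint space `L²_{st}` of the Navier–Stokes strain equation
(ARMA 235 (2020); in the tree `Torus.strainProjection` = `P_{st}`, `TorusStrainProjection.lean`, and
its Fourier symbol, `TorusStrainSubspaceFourier.lean`) —, Hessians, and divergence-free symmetric
fields; they compute the size of the projection, `‖P_{st}(M)‖²_{L²} = 2‖∇×div(−Δ)⁻¹M‖²_{L²}`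
(Prop 2.13, display (1.31)), record the commutator `div P_{st} = P_{df} div` (display (1.47)), and —
towards the question whether the enstrophy-optimal eigenvalue structure `λ₂ = λ₃` (equality in
Miller's `−4det S ≤ (2/9)√6|S|³`, tree `Miller2019.neg_four_mul_det_le`) can occur inside `L²_{st}`
(Conjecture 1.14, OPEN, not vendored) — prove that for a FIXED axis `v` one has
`sup_λ ‖P_{st}(λ(I₃ − 3v⊗v)/√6)‖²_{L²}/‖λ‖²_{L²} = ¾` (Thm 1.17 = Thm 3.3).

This file reads these results on the flat unit torus `T^d = UnitAddTorus d` (any finite nonempty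
index type `d`) for SMOOTH matrix fields `M = (M_{ab})`, with the tree's explicit operator
`P_{st}M = ∇_{sym}z_M`, `z_M = Torus.strainPotential M = 2Δ⁻¹div_{sym}M − 2∇Δ⁻²(div div sym M)`
(`Δ⁻¹` the mean-zero inverse Laplacian), `div_{sym}M = Torus.strainDiv M`,
`div div sym M = Torus.strainDivDiv M`:

§1 THE SIZE OF THE PROJECTION (Prop 2.13 with Miller's isometry Prop 1.10):
* `Torus.integral_sum_strainProjection_sq_eq_torusEnstrophy` — `‖P_{st}M‖²_{L²} = ℰ(z_M) = ½‖∇z_M‖²`;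
* `Torus.integral_sum_strainProjection_sq_eq_half_integral_torusVorticitySqAt` —
  `‖P_{st}M‖²_{L²} = ½‖ω(z_M)‖²` (`torusVorticitySqAt`, `= |∇×z_M|²` in `d = 3`);
* `Torus.partialDeriv_strainPotential_sub_swap` — `∇×z_M = 2∇×Δ⁻¹div_{sym}M` entrywise (the gradient
  part of `z_M` is curl free);
* **`Torus.integral_sum_strainProjection_sq_eq_sum_integral_curl_sq`** — **Prop 2.13**:
  `∫ ∑_{ab}(P_{st}M)_{ab}² = ∑_{ab} ∫ (∂_a g_b − ∂_b g_a)²`, `g = Δ⁻¹div_{sym}M = −(−Δ)⁻¹div(sym M)`,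
  i.e. `‖P_{st}M‖² = 2‖∇×div(−Δ)⁻¹M‖²` in `d = 3`.

§2 THE DIVERGENCE OF A PROJECTED FIELD ((1.47)) AND `L²_{st} ⊆ ker(div²)` (Thm 2.12):
* **`Torus.strainDiv_strainProjection`** — `div_{sym}(P_{st}M) = div_{sym}M − ∇Δ⁻¹(div div sym M)`
  `= ℙ(div_{sym}M)`, `ℙ = Id − ∇Δ⁻¹div` the Leray–Helmholtz projection (`div P_{st} = P_{df} div`);
* `Torus.strainDivDiv_strainProjection` — `div div (P_{st}M) = 0`.

§3 THE KERNEL AND THE DECOMPOSITION (Thm 1.3 = 2.3, Cor 1.6, Prop 2.11):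
* `Torus.strainPotential_eq_zero_of_strainDiv_eq_zero`, `Torus.strainProjection_eq_zero_of_strainDiv_eq_zero`,
  `Torus.integral_sum_mul_symGrad_eq_zero_of_strainDiv_eq_zero` — **`L²_{divfree} ⊆ ker P_{st}`,
  `L²_{divfree} ⊥ L²_{st}`** (the summand that is new relative to Miller 2020, where only
  `L²_{Hess}, L²_{Id} ⊆ (L²_{st})^⊥` was recorded — tree `Torus.strainProjection_hessian/_diagonal`);
* `Torus.strainPotential_eq_zero_of_strainDiv_eq_gradient`, `Torus.strainProjection_eq_zero_of_strainDiv_eq_gradient`,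
  **`Torus.strainProjection_eq_zero_iff_exists_gradient`** — **Cor 1.6**: `P_{st}M = 0 ⟺ div_{sym}M`
  is a gradient (`⟺ sym M ∈ Hess ⊕ ker(div)`);
* **`Torus.strainDiv_symm_sub_hessian_sub_strainProjection`** — **Thm 1.3/2.3**: with
  `φ = Δ⁻²(div div sym M)`, `Q := sym M − Hess φ − P_{st}M` is divergence free, so
  `sym M = Hess φ + P_{st}M + Q ∈ L²_{Hess} + L²_{st} + L²_{divfree}`;
* `Torus.integral_sum_hessian_mul_strainProjection_eq_zero` (`Hess ⊥ P_{st}M`),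
  `Torus.integral_sum_strainProjection_mul_remainder_eq_zero` (`P_{st}M ⊥ Q`),
  `Torus.integral_sum_hessian_mul_eq_integral_mul_strainDivDiv` (**Prop 2.11**:
  `⟨Hess φ, Q⟩ = ∫ φ · div div sym Q`), `Torus.integral_sum_hessian_mul_eq_zero_of_strainDiv_eq_zero`
  (`Hess ⊥ ker(div)`, in particular `Hess φ ⊥ Q`) — the three summands are pairwise orthogonal.

§4 THE FIXED-AXIS BOUND (Thm 1.17 = Thm 3.3, display (1.42)):
* **`Torus.integral_sum_strainProjection_axial_sq_le`** — for `∑_a v_a² = 1` and smooth real `λ`: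
  `‖P_{st}(λ(I − 3v⊗v))‖²_{L²} ≤ (9/2)‖λ‖²_{L²}` in every dimension (printed and cited for `d = 3`
  only — Thm 1.17; the uniform-in-`d` statement is [ours], same proof); for `card d = 3`
  (`|I₃ − 3v⊗v|² = 6`) this is the printed `‖P_{st}(λ(I₃ − 3v⊗v)/√6)‖² ≤ ¾‖λ‖²`. Proof = the
  printed Fourier computation on `ℤ^d` via the tree symbol `Torus.mFourierCoeff_strainProjection_of_symm`
  and Parseval: mode by mode `∑_{ab}|𝓕(P_{st}(λC))_{ab}(k)|² = 18 s(1 − s)|λ̂(k)|²`, `s = (v·k)²/|k|²`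
  (`SymmetricHelmholtz.symbol_sq_sum_le`).

§5 THE COMPRESSION AXIS CANNOT OMIT A DIRECTION (Thm 1.18 = Thm 3.4, torus form):
* `Torus.eq_zero_of_symGrad_eq_axial_of_axis_apply_eq_zero` — a smooth strain of the max-mid form
  `λ(I − 3v⊗v)`, `λ ≥ 0` continuous, whose axis field `v` has an identically vanishing component,
  has `λ ≡ 0` (zero mean of a diagonal strain entry on the torus replaces `u₁ ∈ L⁶ ⊂ Ḣ¹`).

§6 THE RANK-ONE REDUCTION (Prop 3.7, with its proof display
`P_{st}(λ(I₃ − 3v⊗v)/√6) = −(3/√6)P_{st}(√λv ⊗ √λv)`, `w = √λ v`, `‖w‖⁴_{L⁴} = ‖λ‖²_{L²}`):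
* `Torus.strainProjection_smul_id_sub_three_outer` — `P_{st}(λ(I − 3v⊗v)) = −3P_{st}(λ v⊗v)` for
  smooth `λ`, `v` (linearity + `P_{st}(λI) = 0`);
* **`Torus.integral_sum_strainProjection_normSq_id_sub_three_outer_sq_eq`** — for every smooth `w`:
  `‖P_{st}((|w|²I − 3w⊗w)/√6)‖²_{L²} = (3/2)‖P_{st}(w⊗w)‖²_{L²}` (and `∫(|w|²)² = ∫|w|⁴`), i.e. the
  two suprema of Prop 3.7 run over the same set of values under `(λ, v) ↔ w = √λv`,
  `λ(I − 3v⊗v) = |w|²I − 3w⊗w`.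

Scope, deviations, and what is NOT claimed.
* `ℝ³`/`ℝ^d` versus `T^d`: the printed spaces are homogeneous (`(−Δ)^{-1/2}`, `Ḣ¹`); on the torus
  the zero modes are harmless here because `div_{sym}` of a constant field vanishes (constants are
  divergence free, i.e. belong to the third summand) and `Δ⁻¹` is the mean-zero inverse. All
  statements are for smooth fields (the printed ones for `L²` fields; density is not addressed).
  The decomposition is stated through the explicit remainder `Q` and pairwise orthogonality;
  the closedness of the three subspaces / uniqueness of the decomposition in `L²` are not restated.
* Thm 1.17 is typed as the UPPER BOUND `≤ ¾` (display (1.42), "`≤`" part, with the explicit symbol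
  value); the printed near-maximiser statement ((1.43), Thms 3.2/3.3: the supremum `¾` is approached
  by `λ` with `supp λ̂` near the cone `ξ_v² = |ξ|²/2`) is not typed. TORUS REMARK [ours, from the
  symbol identity, not in the source]: on `T³` the value `¾` is ATTAINED by single real Fourier modes
  `λ` with frequency on the cone `(v·k)² = |k|²/2` (e.g. `v = e₃`, `k = (3,4,5)`).
* NOT vendored: Conjecture 1.14 (`L²_{st} ∩ L²_{maxmid} = {0}` with a gap) — an OPEN PROBLEM, not
  literature; Thm 1.19 / Cor 3.6 (gap ⟹ `‖λ₃ − λ₂⁺‖ ≥ (1−r)/√2‖S‖`, conditional on the open gap),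
  the matrix potential equation (1.50)/§4, the anti-symmetric decomposition §6 of the paper, and the
  finer splitting `L²_{divfree} = L²_{Ĩd} ⊕ L²_{tr&divfree}` (Thm 1.5). Thm 3.1
  (`‖S_{vv}‖² ≤ ½‖S‖²` on `L²_{st}`) is typed in `TorusStrainSubspaceFourier`
  (`Torus.integral_sq_symGrad_diag_le_half`); Thm 1.18 is §5 here (torus form); Prop 3.7 is §6
  (as the identity behind the equality of suprema; the suprema themselves, over `L²`/`L⁴` classes,
  are not formed).
* Relevance for the functional-mining cell (pub-nsfunc): Prop 2.13 is the "size of `Q = P_{st}(…)`"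
  needed to evaluate Miller's perturbative ratios (tree `TorusNSStrainProjectionCriterion`), and
  Thm 1.17 is a geometric constraint on enstrophy-optimal strain configurations (fixed-axis axial
  compression loses at least a quarter of its `L²` mass under `P_{st}`). Search for candidate a priori
  estimates; no regularity claim.

## Mathlib / tree search

Tree: `Torus.strainProjection`, `Torus.strainPotential(_apply)`, `Torus.strainDiv`, `Torus.strainDivDiv`,
`Torus.isDivFree_strainPotential`, `Torus.strainProjection_comm/_hessian`,
`Torus.integral_sum_strainProjection_mul_comm/_mul_symGrad_eq/_sq_eq` (`TorusStrainProjection`);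
`Torus.mFourierCoeff_strainProjection_of_symm/_zero`, `Torus.hasSum_sq_mFourierCoeff_strainProjection`
(`TorusStrainSubspaceFourier`); `integral_strainNormSq_eq_torusEnstrophy`,
`integral_strainNormSq_eq_half_integral_torusVorticitySqAt` (`TorusStrainVorticityIsometry`);
`Torus.laplacian_invLaplacian`, `Torus.invLaplacian_laplacian`, `Torus.partialDeriv_invLaplacian`,
`Torus.integral_invLaplacian`, `Torus.invLaplacian_zero`, `Torus.partialDeriv_comm`,
`Torus.partialDeriv_laplacian_comm`, `Torus.laplacian_eq_sum_partialDeriv_partialDeriv`,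
`Torus.integral_partialDeriv_eq_zero_holds`, `Torus.mFourierCoeff_const_smul`,
`Torus.hasSum_sq_mFourierCoeff_ofReal`, `Torus.one_le_freqNormSq_of_ne_zero`.
`Torus.strainProjection_sub/_const_mul` (`TorusNSStrainEquationProjected`), `Torus.strainProjection_diagonal`.
`lean search 'Helmholtz.*symmetric|strainDiv_strainProjection|curl.*strainPotential'`: nothing beyond the above.

## References

* E. Miller, E. Sawyer, *A Helmholtz-type decomposition for the space of symmetric matrices*,
  Trans. Amer. Math. Soc. Ser. B 10 (2023) 1449–1493, doi:10.1090/btran/167 = arXiv:2111.12891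
  (held text `paper:arxiv-2111.12891`): Thm 1.3, Def 1.4, Thm 1.5, Cor 1.6, Thm 1.9 with display
  (1.31), Prop 1.10, Def 1.13, Conj 1.14, Thm 1.17 with (1.42)–(1.43), display (1.47) (chunks 3–7);
  Prop 2.1, Thm 2.3 (chunks 8–10); Prop 2.11, Thm 2.12, Prop 2.13 with proof, Prop 2.14 (chunks 13–14);
  §3 Thms 3.1–3.4, Thm 3.5, Cor 3.6, Prop 3.7 with proof (chunks 15–18); §5 Thm 5.4 (general `d`,
  chunk 23). [MillerSawyer2023]
* E. Miller, Arch. Ration. Mech. Anal. 235 (2020) 99–139 = arXiv:1710.05569, Def 2.2, display (2.7),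
  Prop 2.3, Prop 2.4, Prop 3.1 (held text chunks 8–10). [Miller2019]
* E. Miller, Anal. PDE 16 (2023) 997–1032 = arXiv:1910.05415, Def 1.2 and (1.9) (`P_{st}`). [Miller2023StrainModel]
* A. Majda, A. Bertozzi, *Vorticity and Incompressible Flow*, CUP 2002, §1.4 (1.19)–(1.21), (1.31)
  (vorticity tensor / `|∇×v|²`). [MajdaBertozziCUP2002]
-/

noncomputable section

open MeasureTheory Set Function Finset UnitAddTorus
open scoped ContDiff InnerProductSpace RealInnerProductSpace

namespace Literature.Analysis.FluidPDE

open Literature.Analysis.FunctionSpaces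

variable {d : Type*} [Fintype d] [DecidableEq d]

namespace SymmetricHelmholtz

variable {M : d → d → UnitAddTorus d → ℝ}

/-! ### Smoothness and calculus helpers (plumbing) -/

omit [DecidableEq d] in
/-- Finite sums of smooth scalar functions are smooth. [folklore] -/
private theorem isSmooth_sum {ι : Type*} (s : Finset ι) {g : ι → UnitAddTorus d → ℝ}
    (hg : ∀ i ∈ s, Torus.IsSmooth (g i)) : Torus.IsSmooth (fun x => ∑ i ∈ s, g i x) := by
  have hl : Torus.lift (fun x => ∑ i ∈ s, g i x) = fun z => ∑ i ∈ s, Torus.lift (g i) z := rfl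
  unfold Torus.IsSmooth
  rw [hl]
  exact ContDiff.sum fun i hi => hg i hi

omit [DecidableEq d] in
/-- Products of smooth scalar functions are smooth. [folklore] -/
private theorem smooth_mul {a b : UnitAddTorus d → ℝ} (ha : Torus.IsSmooth a) (hb : Torus.IsSmooth b) :
    Torus.IsSmooth (fun y => a y * b y) := ha.mul hb

omit [DecidableEq d] in
/-- Constant multiples of smooth scalar functions are smooth. [folklore] -/
private theorem smooth_const_mul (c : ℝ) {a : UnitAddTorus d → ℝ} (ha : Torus.IsSmooth a) :
    Torus.IsSmooth (fun y => c * a y) := (Torus.isSmooth_const c).mul ha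

omit [DecidableEq d] in
/-- Squares of smooth scalar functions are smooth. [folklore] -/
private theorem smooth_sq {a : UnitAddTorus d → ℝ} (ha : Torus.IsSmooth a) :
    Torus.IsSmooth (fun y => a y ^ 2) := ha.pow 2

omit [DecidableEq d] in
/-- The symmetrised entries `½(M_{cb} + M_{bc})` are smooth. [folklore] -/
private theorem isSmooth_symm (hM : ∀ a b, Torus.IsSmooth (M a b)) (c b : d) :
    Torus.IsSmooth (fun z => (M c b z + M b c z) / 2) :=
  ((hM c b).add (hM b c)).div_const 2

/-- `∂ᵢ(c f) = c ∂ᵢf` for a `C¹` scalar function. [folklore] -/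
private theorem partialDeriv_const_mul' {f : UnitAddTorus d → ℝ} (hf : Torus.IsContDiff 1 f) (c : ℝ)
    (i : d) (x : UnitAddTorus d) :
    Torus.partialDeriv i (fun y => c * f y) x = c * Torus.partialDeriv i f x := by
  have h := congrFun (Torus.partialDeriv_const_smul hf c i) x
  have e : (fun y => c * f y) = c • f := by funext y; simp [smul_eq_mul]
  rw [e, h, Pi.smul_apply, smul_eq_mul]

/-- `∂ᵢ(f − g) = ∂ᵢf − ∂ᵢg` for `C¹` functions. [folklore] -/
private theorem partialDeriv_sub' {F : Type*} [NormedAddCommGroup F] [NormedSpace ℝ F]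
    {f g : UnitAddTorus d → F} (hf : Torus.IsContDiff 1 f) (hg : Torus.IsContDiff 1 g)
    (i : d) (x : UnitAddTorus d) :
    Torus.partialDeriv i (fun y => f y - g y) x = Torus.partialDeriv i f x - Torus.partialDeriv i g x := by
  have hneg : Torus.IsContDiff 1 (fun y => -g y) := hg.neg
  have hfun : (fun y => f y - g y) = f + fun y => -g y := by
    funext y; simp [sub_eq_add_neg]
  rw [hfun, Torus.partialDeriv_add hf hneg i, Pi.add_apply, Torus.partialDeriv_neg, sub_eq_add_neg]

/-- `∂ᵢ(f + g) = ∂ᵢf + ∂ᵢg` for `C¹` functions (pointwise-lambda form). [folklore] -/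
private theorem partialDeriv_add' {F : Type*} [NormedAddCommGroup F] [NormedSpace ℝ F]
    {f g : UnitAddTorus d → F} (hf : Torus.IsContDiff 1 f) (hg : Torus.IsContDiff 1 g)
    (i : d) (x : UnitAddTorus d) :
    Torus.partialDeriv i (fun y => f y + g y) x = Torus.partialDeriv i f x + Torus.partialDeriv i g x := by
  have hfun : (fun y => f y + g y) = f + g := by funext y; simp
  rw [hfun, Torus.partialDeriv_add hf hg i, Pi.add_apply]

/-- `∂ᵢ((f + g)/2) = (∂ᵢf + ∂ᵢg)/2` for `C¹` scalar functions. [folklore] -/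
private theorem partialDeriv_half_add {f g : UnitAddTorus d → ℝ} (hf : Torus.IsContDiff 1 f)
    (hg : Torus.IsContDiff 1 g) (i : d) (x : UnitAddTorus d) :
    Torus.partialDeriv i (fun y => (f y + g y) / 2) x =
      (Torus.partialDeriv i f x + Torus.partialDeriv i g x) / 2 := by
  have e : (fun y => (f y + g y) / 2) = fun y => 2⁻¹ * (fun y => f y + g y) y := by
    funext y; simp only; ring
  have hfg : Torus.IsContDiff 1 (fun y => f y + g y) := hf.add hg
  rw [e, partialDeriv_const_mul' hfg, partialDeriv_add' hf hg]
  ring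

omit [Fintype d] in
/-- `∂ᵢ` of a constant vanishes. [folklore] -/
private theorem partialDeriv_const' {F : Type*} [NormedAddCommGroup F] [NormedSpace ℝ F] (c : F)
    (i : d) (x : UnitAddTorus d) : Torus.partialDeriv i (fun _ : UnitAddTorus d => c) x = 0 := by
  simp [Torus.partialDeriv, Torus.lineDeriv]

/-- Integration by parts for one partial derivative on the torus: `∫ (∂ᵢa) b = −∫ a (∂ᵢb)` for
smooth real `a`, `b` (empty boundary). [folklore] -/
private theorem integral_partialDeriv_mul_eq_neg {a b : UnitAddTorus d → ℝ} (ha : Torus.IsSmooth a)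
    (hb : Torus.IsSmooth b) (i : d) :
    ∫ x, Torus.partialDeriv i a x * b x = -∫ x, a x * Torus.partialDeriv i b x := by
  have h0 : ∫ x, Torus.partialDeriv i (fun y => a y * b y) x = 0 :=
    Torus.integral_partialDeriv_eq_zero_holds (smooth_mul ha hb) i
  simp_rw [Torus.partialDeriv_mul (ha.isContDiff (by simp)) (hb.isContDiff (by simp))] at h0
  rw [integral_add (smooth_mul ha (hb.partialDeriv i)).integrable
    (smooth_mul (ha.partialDeriv i) hb).integrable] at h0
  linarith

/-- The mean of each component of `div_{sym}M` vanishes (a sum of derivatives of smooth periodic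
functions). [folklore] -/
private theorem integral_strainDiv (hM : ∀ a b, Torus.IsSmooth (M a b)) (b : d) :
    ∫ y, Torus.strainDiv M b y = 0 := by
  have e : Torus.strainDiv M b = fun y => ∑ c, Torus.partialDeriv c (fun z => (M c b z + M b c z) / 2) y := by
    funext y; rfl
  rw [e, integral_finsetSum _ fun c _ => ((isSmooth_symm hM c b).partialDeriv c).integrable]
  exact Finset.sum_eq_zero fun c _ => Torus.integral_partialDeriv_eq_zero_holds (isSmooth_symm hM c b) c

/-- The mean of `div div sym M` vanishes. [folklore] -/
private theorem integral_strainDivDiv (hM : ∀ a b, Torus.IsSmooth (M a b)) :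
    ∫ y, Torus.strainDivDiv M y = 0 := by
  have e : Torus.strainDivDiv M = fun y => ∑ b, Torus.partialDeriv b (Torus.strainDiv M b) y := by
    funext y; rfl
  rw [e, integral_finsetSum _ fun b _ => ((Torus.isSmooth_strainDiv hM b).partialDeriv b).integrable]
  exact Finset.sum_eq_zero fun b _ => Torus.integral_partialDeriv_eq_zero_holds (Torus.isSmooth_strainDiv hM b) b

/-- The derivative of a component of the potential `z_M`:
`(∂_a z_M)_b = 2∂_aΔ⁻¹(div_{sym}M)_b − 2∂_a∂_bΔ⁻²(div div sym M)`. [folklore] -/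
private theorem partialDeriv_strainPotential (hM : ∀ a b, Torus.IsSmooth (M a b)) (a b : d)
    (x : UnitAddTorus d) :
    Torus.partialDeriv a (Torus.strainPotential M) x b =
      2 * Torus.partialDeriv a (Torus.invLaplacian (Torus.strainDiv M b)) x -
        2 * Torus.partialDeriv a (Torus.partialDeriv b
          (Torus.invLaplacian (Torus.invLaplacian (Torus.strainDivDiv M)))) x := by
  have hZ1 : Torus.IsContDiff 1 (Torus.strainPotential M) :=
    (Torus.isSmooth_strainPotential hM).isContDiff (by simp)
  have h1 : Torus.IsSmooth (Torus.invLaplacian (Torus.strainDiv M b)) :=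
    Torus.isSmooth_invLaplacian (Torus.isSmooth_strainDiv hM b)
  have h2 : Torus.IsSmooth (Torus.partialDeriv b
      (Torus.invLaplacian (Torus.invLaplacian (Torus.strainDivDiv M)))) :=
    (Torus.isSmooth_invLaplacian (Torus.isSmooth_invLaplacian (Torus.isSmooth_strainDivDiv hM))).partialDeriv b
  rw [← Torus.partialDeriv_apply_coord hZ1 a x b]
  have e : (fun y => Torus.strainPotential M y b) =
      fun y => (fun y => 2 * Torus.invLaplacian (Torus.strainDiv M b) y) y -
        (fun y => 2 * Torus.partialDeriv b
          (Torus.invLaplacian (Torus.invLaplacian (Torus.strainDivDiv M))) y) y := by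
    funext y; rfl
  rw [e, partialDeriv_sub' ((smooth_const_mul 2 h1).isContDiff (by simp))
      ((smooth_const_mul 2 h2).isContDiff (by simp)),
    partialDeriv_const_mul' (h1.isContDiff (by simp)), partialDeriv_const_mul' (h2.isContDiff (by simp))]

/-! ### §1 The size of the projection (Miller–Sawyer, Prop 2.13; Miller's isometry, Prop 1.10) -/

/-- **`‖P_{st}M‖²_{L²} = ℰ(z_M) = ½‖∇z_M‖²_{L²}`** on `T^d`: the first step of the printed proof of
Prop 2.13 — `‖P_{st}(M)‖²_{L²} = ‖∇_{sym}(−Δ)^{-1/2}u‖²_{L²}` with Miller's isometry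
`‖∇_{sym}v‖² = ½‖∇v‖²` for divergence-free `v` (Prop 1.10, first equality) — for the tree's
explicit representative `P_{st}M = ∇_{sym}z_M`, `z_M = Torus.strainPotential M` divergence free
(`Torus.isDivFree_strainPotential`). [cite: MillerSawyer2023, Prop 2.13 (proof) and Prop 1.10] -/
theorem _root_.Literature.Analysis.FluidPDE.Torus.integral_sum_strainProjection_sq_eq_torusEnstrophy
    [Nonempty d] (hM : ∀ a b, Torus.IsSmooth (M a b)) :
    ∫ x, ∑ a, ∑ b, Torus.strainProjection M a b x ^ 2 =
      torusEnstrophy (Torus.strainPotential M) := by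
  rw [← integral_strainNormSq_eq_torusEnstrophy (Torus.isSmooth_strainPotential hM)
    (Torus.isDivFree_strainPotential hM)]
  refine integral_congr_ae (Filter.Eventually.of_forall fun x => ?_)
  refine Finset.sum_congr rfl fun a _ => Finset.sum_congr rfl fun b _ => ?_
  simp only [Torus.strainProjection]
  ring

/-- **`‖P_{st}M‖²_{L²} = ½‖ω(z_M)‖²_{L²}`** on `T^d` (Prop 1.10, second equality:
`‖∇_{sym}(−Δ)^{-1/2}u‖² = ½‖∇×(−Δ)^{-1/2}u‖²`), with the tree's orientation-free squared vorticity
`torusVorticitySqAt v x = ½∑ᵢⱼ((∂ᵢv)ⱼ − (∂ⱼv)ᵢ)²` (`= |∇×v(x)|²` when `card d = 3`,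
`TorusNSVorticityLsCriterion.torusVorticitySqAt_eq_sum_curl_sq`). [cite: MillerSawyer2023, Prop 1.10 and Prop 2.13 (proof)] -/
theorem _root_.Literature.Analysis.FluidPDE.Torus.integral_sum_strainProjection_sq_eq_half_integral_torusVorticitySqAt
    [Nonempty d] (hM : ∀ a b, Torus.IsSmooth (M a b)) :
    ∫ x, ∑ a, ∑ b, Torus.strainProjection M a b x ^ 2 =
      2⁻¹ * ∫ x, torusVorticitySqAt (Torus.strainPotential M) x := by
  rw [← integral_strainNormSq_eq_half_integral_torusVorticitySqAt (Torus.isSmooth_strainPotential hM)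
    (Torus.isDivFree_strainPotential hM)]
  refine integral_congr_ae (Filter.Eventually.of_forall fun x => ?_)
  refine Finset.sum_congr rfl fun a _ => Finset.sum_congr rfl fun b _ => ?_
  simp only [Torus.strainProjection]
  ring

/-- **The curl of the potential**: `(∂_a z_M)_b − (∂_b z_M)_a = 2(∂_aΔ⁻¹(div_{sym}M)_b − ∂_bΔ⁻¹(div_{sym}M)_a)`
pointwise — the gradient part `−2∇Δ⁻²(div div sym M)` of `z_M` is curl free (Schwarz), which is the
printed step "taking the curl and inverting the Laplacian, `−2∇×div(−Δ)⁻¹M = ∇×(−Δ)^{-1/2}u`".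
[cite: MillerSawyer2023, Prop 2.13 (proof)] -/
theorem _root_.Literature.Analysis.FluidPDE.Torus.partialDeriv_strainPotential_sub_swap
    (hM : ∀ a b, Torus.IsSmooth (M a b)) (a b : d) (x : UnitAddTorus d) :
    Torus.partialDeriv a (Torus.strainPotential M) x b - Torus.partialDeriv b (Torus.strainPotential M) x a =
      2 * (Torus.partialDeriv a (Torus.invLaplacian (Torus.strainDiv M b)) x -
        Torus.partialDeriv b (Torus.invLaplacian (Torus.strainDiv M a)) x) := by
  have hψ : Torus.IsSmooth (Torus.invLaplacian (Torus.invLaplacian (Torus.strainDivDiv M))) :=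
    Torus.isSmooth_invLaplacian (Torus.isSmooth_invLaplacian (Torus.isSmooth_strainDivDiv hM))
  rw [partialDeriv_strainPotential hM a b x, partialDeriv_strainPotential hM b a x,
    Torus.partialDeriv_comm hψ a b x]
  ring

/-- **Miller–Sawyer, Prop 2.13 on `T^d` — the size of the strain projection**:
`‖P_{st}(M)‖²_{L²} = 2‖∇×div(−Δ)⁻¹M‖²_{L²}`, here for a smooth matrix field `M` on `T^d` in the
orientation-free form valid in every dimension,
`∫ ∑_{ab} (P_{st}M)_{ab}² = ∑_{ab} ∫ (∂_a g_b − ∂_b g_a)²`, `g_b = Δ⁻¹(div_{sym}M)_b`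
(`g = −(−Δ)⁻¹div(sym M)`; `½∑_{ab}(∂_a g_b − ∂_b g_a)² = |∇×g|²` when `card d = 3`). Printed proof
followed: `‖P_{st}M‖² = ‖∇_{sym}z‖² = ½‖∇×z‖²` (isometry) and `∇×z_M = −2∇×(−Δ)⁻¹div(sym M)`.
[cite: MillerSawyer2023, Prop 2.13] -/
theorem _root_.Literature.Analysis.FluidPDE.Torus.integral_sum_strainProjection_sq_eq_sum_integral_curl_sq
    [Nonempty d] (hM : ∀ a b, Torus.IsSmooth (M a b)) :
    ∫ x, ∑ a, ∑ b, Torus.strainProjection M a b x ^ 2 =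
      ∑ a, ∑ b, ∫ x, (Torus.partialDeriv a (Torus.invLaplacian (Torus.strainDiv M b)) x -
        Torus.partialDeriv b (Torus.invLaplacian (Torus.strainDiv M a)) x) ^ 2 := by
  have hg : ∀ b, Torus.IsSmooth (Torus.invLaplacian (Torus.strainDiv M b)) := fun b =>
    Torus.isSmooth_invLaplacian (Torus.isSmooth_strainDiv hM b)
  set D : d → d → UnitAddTorus d → ℝ := fun a b x =>
    Torus.partialDeriv a (Torus.invLaplacian (Torus.strainDiv M b)) x -
      Torus.partialDeriv b (Torus.invLaplacian (Torus.strainDiv M a)) x with hD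
  have hDs : ∀ a b, Torus.IsSmooth (D a b) := fun a b => ((hg b).partialDeriv a).sub ((hg a).partialDeriv b)
  have hpt : ∀ x, torusVorticitySqAt (Torus.strainPotential M) x = 2 * ∑ a, ∑ b, D a b x ^ 2 := by
    intro x
    unfold torusVorticitySqAt
    simp_rw [Torus.partialDeriv_strainPotential_sub_swap hM]
    rw [Finset.mul_sum, Finset.mul_sum]
    refine Finset.sum_congr rfl fun a _ => ?_
    rw [Finset.mul_sum, Finset.mul_sum]
    refine Finset.sum_congr rfl fun b _ => ?_
    simp only [hD]
    ring
  rw [Torus.integral_sum_strainProjection_sq_eq_half_integral_torusVorticitySqAt hM]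
  simp_rw [hpt]
  have hrow : ∀ a, Integrable (fun x => ∑ b, D a b x ^ 2) volume := fun a =>
    (isSmooth_sum _ fun b _ => smooth_sq (hDs a b)).integrable
  rw [MeasureTheory.integral_const_mul, integral_finsetSum _ fun a _ => hrow a,
    show (2⁻¹ : ℝ) * (2 * ∑ a, ∫ x, ∑ b, D a b x ^ 2) = ∑ a, ∫ x, ∑ b, D a b x ^ 2 by ring]
  refine Finset.sum_congr rfl fun a _ => ?_
  rw [integral_finsetSum _ fun b _ => (smooth_sq (hDs a b)).integrable]

/-! ### §2 The divergence of a projected field: `div P_{st} = P_{df} div` (Miller–Sawyer (1.47)) -/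

/-- `∑_c ∂_c (∂_b v)_c = 0` pointwise for a smooth divergence-free field (`= ∂_b div v`). [folklore] -/
private theorem sum_partialDeriv_partialDeriv_apply_eq_zero {v : UnitAddTorus d → EuclideanSpace ℝ d}
    (hv : Torus.IsSmooth v) (hdiv : Torus.IsDivFree v) (b : d) (x : UnitAddTorus d) :
    ∑ c, Torus.partialDeriv c (fun y => Torus.partialDeriv b v y c) x = 0 := by
  have hv1 : Torus.IsContDiff 1 v := hv.isContDiff (by simp)
  have hD1 : ∀ m, Torus.IsContDiff 1 (Torus.partialDeriv m v) := fun m =>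
    (hv.partialDeriv m).isContDiff (by simp)
  have hDc1 : ∀ m j, Torus.IsContDiff 1 (fun y => Torus.partialDeriv m v y j) := fun m j =>
    ((hv.partialDeriv m).apply j).isContDiff (by simp)
  have h1 : ∀ c, Torus.partialDeriv c (fun y => Torus.partialDeriv b v y c) x =
      Torus.partialDeriv b (fun y => Torus.partialDeriv c v y c) x := by
    intro c
    rw [Torus.partialDeriv_apply_coord (hD1 b), Torus.partialDeriv_apply_coord (hD1 c),
      Torus.partialDeriv_comm hv c b x]
  simp_rw [h1]
  rw [← Torus.partialDeriv_finset_sum Finset.univ (fun c _ => hDc1 c c)]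
  have hdivfun : (fun y => ∑ c, Torus.partialDeriv c v y c) = fun _ => (0 : ℝ) := by
    funext y
    rw [← Torus.divergence_eq_sum_partialDeriv_apply hv1]
    exact hdiv y
  rw [hdivfun]
  exact partialDeriv_const' _ _ _

/-- `∑_c ∂_c(∂_c z_M)_b = 2(div_{sym}M)_b − 2∂_bΔ⁻¹(div div sym M)` pointwise: the Laplacian of a
component of the potential (`ΔΔ⁻¹h = h − ∫h`, `∫(div_{sym}M)_b = 0`, `Δ∂_bΔ⁻² = ∂_bΔ⁻¹`). [folklore] -/
private theorem sum_partialDeriv_partialDeriv_strainPotential [Nonempty d]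
    (hM : ∀ a b, Torus.IsSmooth (M a b)) (b : d) (x : UnitAddTorus d) :
    ∑ c, Torus.partialDeriv c (fun y => Torus.partialDeriv c (Torus.strainPotential M) y b) x =
      2 * Torus.strainDiv M b x -
        2 * Torus.partialDeriv b (Torus.invLaplacian (Torus.strainDivDiv M)) x := by
  have hhs : Torus.IsSmooth (Torus.strainDiv M b) := Torus.isSmooth_strainDiv hM b
  have hgs : Torus.IsSmooth (Torus.strainDivDiv M) := Torus.isSmooth_strainDivDiv hM
  have hIh : Torus.IsSmooth (Torus.invLaplacian (Torus.strainDiv M b)) := Torus.isSmooth_invLaplacian hhs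
  have hIg : Torus.IsSmooth (Torus.invLaplacian (Torus.strainDivDiv M)) := Torus.isSmooth_invLaplacian hgs
  have hψ : Torus.IsSmooth (Torus.invLaplacian (Torus.invLaplacian (Torus.strainDivDiv M))) :=
    Torus.isSmooth_invLaplacian hIg
  have e : ∀ c, (fun y => Torus.partialDeriv c (Torus.strainPotential M) y b) =
      fun y => (fun y => 2 * Torus.partialDeriv c (Torus.invLaplacian (Torus.strainDiv M b)) y) y -
        (fun y => 2 * Torus.partialDeriv c (Torus.partialDeriv b
          (Torus.invLaplacian (Torus.invLaplacian (Torus.strainDivDiv M)))) y) y := by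
    intro c; funext y; exact partialDeriv_strainPotential hM c b y
  have step : ∀ c, Torus.partialDeriv c (fun y => Torus.partialDeriv c (Torus.strainPotential M) y b) x =
      2 * Torus.partialDeriv c (Torus.partialDeriv c (Torus.invLaplacian (Torus.strainDiv M b))) x -
        2 * Torus.partialDeriv c (Torus.partialDeriv c (Torus.partialDeriv b
          (Torus.invLaplacian (Torus.invLaplacian (Torus.strainDivDiv M))))) x := by
    intro c
    have h1 : Torus.IsSmooth (Torus.partialDeriv c (Torus.invLaplacian (Torus.strainDiv M b))) :=
      hIh.partialDeriv c
    have h2 : Torus.IsSmooth (Torus.partialDeriv c (Torus.partialDeriv b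
        (Torus.invLaplacian (Torus.invLaplacian (Torus.strainDivDiv M))))) :=
      (hψ.partialDeriv b).partialDeriv c
    rw [e c, partialDeriv_sub' ((smooth_const_mul 2 h1).isContDiff (by simp))
        ((smooth_const_mul 2 h2).isContDiff (by simp)),
      partialDeriv_const_mul' (h1.isContDiff (by simp)), partialDeriv_const_mul' (h2.isContDiff (by simp))]
  simp_rw [step]
  rw [Finset.sum_sub_distrib, ← Finset.mul_sum, ← Finset.mul_sum,
    ← Torus.laplacian_eq_sum_partialDeriv_partialDeriv hIh x,
    ← Torus.laplacian_eq_sum_partialDeriv_partialDeriv (hψ.partialDeriv b) x,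
    Torus.laplacian_invLaplacian hhs x, integral_strainDiv hM b, sub_zero,
    ← Torus.partialDeriv_laplacian_comm hψ b x]
  have hΔψ : Torus.laplacian (Torus.invLaplacian (Torus.invLaplacian (Torus.strainDivDiv M))) =
      Torus.invLaplacian (Torus.strainDivDiv M) := by
    funext y
    rw [Torus.laplacian_invLaplacian hIg y, Torus.integral_invLaplacian hgs, sub_zero]
  rw [hΔψ]

/-- **Miller–Sawyer (1.47), `div P_{st} = P_{df} div`, on `T^d`**: for a smooth matrix field `M`,
`div_{sym}(P_{st}M) = div_{sym}M − ∇Δ⁻¹(div div sym M) = ℙ(div_{sym}M)` componentwise, `ℙ = Id − ∇Δ⁻¹div`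
the Leray–Helmholtz projection of smooth vector fields on the torus (the printed commutator relation
"`divr P_{st} = P_{df} divr`", which drives the Navier–Stokes matrix potential equation (1.50)).
Proof: `div_{sym}∇_{sym}z = ½Δz + ½∇div z = ½Δz_M` and `Δz_M = 2div_{sym}M − 2∇Δ⁻¹div div sym M`.
[cite: MillerSawyer2023, display (1.47)] -/
theorem _root_.Literature.Analysis.FluidPDE.Torus.strainDiv_strainProjection [Nonempty d]
    (hM : ∀ a b, Torus.IsSmooth (M a b)) (b : d) (x : UnitAddTorus d) :
    Torus.strainDiv (Torus.strainProjection M) b x =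
      Torus.strainDiv M b x - Torus.partialDeriv b (Torus.invLaplacian (Torus.strainDivDiv M)) x := by
  have hZ : Torus.IsSmooth (Torus.strainPotential M) := Torus.isSmooth_strainPotential hM
  have hDc : ∀ m j, Torus.IsSmooth (fun y => Torus.partialDeriv m (Torus.strainPotential M) y j) :=
    fun m j => (hZ.partialDeriv m).apply j
  have e1 : ∀ c, (fun z => (Torus.strainProjection M c b z + Torus.strainProjection M b c z) / 2) =
      fun z => ((fun y => Torus.partialDeriv c (Torus.strainPotential M) y b) z +
        (fun y => Torus.partialDeriv b (Torus.strainPotential M) y c) z) / 2 := by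
    intro c; funext z
    rw [Torus.strainProjection_comm M b c z]
    simp only [Torus.strainProjection]
    ring
  have e2 : ∀ c, Torus.partialDeriv c
      (fun z => (Torus.strainProjection M c b z + Torus.strainProjection M b c z) / 2) x =
      (Torus.partialDeriv c (fun y => Torus.partialDeriv c (Torus.strainPotential M) y b) x +
        Torus.partialDeriv c (fun y => Torus.partialDeriv b (Torus.strainPotential M) y c) x) / 2 := by
    intro c
    rw [e1 c, partialDeriv_half_add ((hDc c b).isContDiff (by simp)) ((hDc b c).isContDiff (by simp))]
  have lhs : Torus.strainDiv (Torus.strainProjection M) b x =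
      ∑ c, Torus.partialDeriv c
        (fun z => (Torus.strainProjection M c b z + Torus.strainProjection M b c z) / 2) x := rfl
  rw [lhs]
  simp_rw [e2]
  rw [← Finset.sum_div, Finset.sum_add_distrib, sum_partialDeriv_partialDeriv_strainPotential hM b x,
    sum_partialDeriv_partialDeriv_apply_eq_zero hZ (Torus.isDivFree_strainPotential hM) b x, add_zero]
  ring

/-- **Strains are `div div`-free**: `div div (P_{st}M) = 0` on `T^d` for every smooth matrix field
(`div(div_{sym}M − ∇Δ⁻¹div div sym M) = div div sym M − ΔΔ⁻¹(div div sym M) = ∫ div div sym M = 0`) —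
the inclusion `L²_{st} ⊆ ker(div²)` of Miller–Sawyer's Thm 1.9 = 2.12, `L²_{st} = ker(div²) ⊖ ker(div)`.
[cite: MillerSawyer2023, Thm 2.12] -/
theorem _root_.Literature.Analysis.FluidPDE.Torus.strainDivDiv_strainProjection [Nonempty d]
    (hM : ∀ a b, Torus.IsSmooth (M a b)) (x : UnitAddTorus d) :
    Torus.strainDivDiv (Torus.strainProjection M) x = 0 := by
  have hsd : ∀ b, Torus.IsSmooth (Torus.strainDiv M b) := fun b => Torus.isSmooth_strainDiv hM b
  have hsdd : Torus.IsSmooth (Torus.strainDivDiv M) := Torus.isSmooth_strainDivDiv hM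
  have hIg : Torus.IsSmooth (Torus.invLaplacian (Torus.strainDivDiv M)) := Torus.isSmooth_invLaplacian hsdd
  have e : ∀ b, Torus.strainDiv (Torus.strainProjection M) b =
      fun y => Torus.strainDiv M b y -
        Torus.partialDeriv b (Torus.invLaplacian (Torus.strainDivDiv M)) y :=
    fun b => funext fun y => Torus.strainDiv_strainProjection hM b y
  have step : ∀ b, Torus.partialDeriv b (Torus.strainDiv (Torus.strainProjection M) b) x =
      Torus.partialDeriv b (Torus.strainDiv M b) x -
        Torus.partialDeriv b (Torus.partialDeriv b (Torus.invLaplacian (Torus.strainDivDiv M))) x := by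
    intro b
    rw [e b, partialDeriv_sub' ((hsd b).isContDiff (by simp)) ((hIg.partialDeriv b).isContDiff (by simp))]
  have lhs : Torus.strainDivDiv (Torus.strainProjection M) x =
      ∑ b, Torus.partialDeriv b (Torus.strainDiv (Torus.strainProjection M) b) x := rfl
  rw [lhs]
  simp_rw [step]
  rw [Finset.sum_sub_distrib, ← Torus.laplacian_eq_sum_partialDeriv_partialDeriv hIg x,
    Torus.laplacian_invLaplacian hsdd x, integral_strainDivDiv hM, sub_zero]
  have rhs : Torus.strainDivDiv M x = ∑ b, Torus.partialDeriv b (Torus.strainDiv M b) x := rfl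
  rw [rhs, sub_self]

/-! ### §3 The kernel of `P_{st}` and the orthogonal decomposition (Miller–Sawyer, Thm 1.3 = 2.3, Cor 1.6) -/

/-- **Divergence-free symmetric fields have zero potential**: `div_{sym}M = 0 ⟹ z_M = 0`
(`z_M = 2Δ⁻¹div_{sym}M − 2∇Δ⁻²div div sym M`). [cite: MillerSawyer2023, Thm 2.3 (`L²_{divfree} ⊥ L²_{st}`)] -/
theorem _root_.Literature.Analysis.FluidPDE.Torus.strainPotential_eq_zero_of_strainDiv_eq_zero
    (h0 : ∀ b y, Torus.strainDiv M b y = 0) (y : UnitAddTorus d) :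
    Torus.strainPotential M y = 0 := by
  have e1 : ∀ b, Torus.strainDiv M b = 0 := fun b => funext fun z => h0 b z
  have e2 : Torus.strainDivDiv M = 0 := by
    funext z
    show ∑ b, Torus.partialDeriv b (Torus.strainDiv M b) z = 0
    simp_rw [e1]
    exact Finset.sum_eq_zero fun b _ => by simp [Torus.partialDeriv, Torus.lineDeriv]
  ext b
  rw [Torus.strainPotential_apply, e1, e2, Torus.invLaplacian_zero, Torus.invLaplacian_zero]
  simp [Torus.partialDeriv, Torus.lineDeriv]

/-- **`L²_{divfree} ⊆ ker P_{st}`** (the new summand of Miller–Sawyer's decomposition relative to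
Miller 2020: trace-free or not, a symmetric field with `div_{sym}M = 0` is annihilated by the strain
projection). [cite: MillerSawyer2023, Thm 2.3 and Cor 1.6] -/
theorem _root_.Literature.Analysis.FluidPDE.Torus.strainProjection_eq_zero_of_strainDiv_eq_zero
    (h0 : ∀ b y, Torus.strainDiv M b y = 0) (a b : d) (x : UnitAddTorus d) :
    Torus.strainProjection M a b x = 0 := by
  have hz : Torus.strainPotential M = fun _ => 0 :=
    funext fun y => Torus.strainPotential_eq_zero_of_strainDiv_eq_zero h0 y
  simp only [Torus.strainProjection, hz, partialDeriv_const']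
  simp

/-- **`L²_{divfree} ⊥ L²_{st}`** on `T^d` (Miller–Sawyer, Thm 2.3, orthogonality part): a smooth
matrix field with `div_{sym}M = 0` is `L²`-orthogonal to every smooth strain `∇_{sym}u`, `∇·u = 0`:
`∫ ∑_{ab} M_{ab} · ½((∂_b u)_a + (∂_a u)_b) = 0`. [cite: MillerSawyer2023, Thm 2.3] -/
theorem _root_.Literature.Analysis.FluidPDE.Torus.integral_sum_mul_symGrad_eq_zero_of_strainDiv_eq_zero
    [Nonempty d] (hM : ∀ a b, Torus.IsSmooth (M a b)) (h0 : ∀ b y, Torus.strainDiv M b y = 0)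
    {u : UnitAddTorus d → EuclideanSpace ℝ d} (hu : Torus.IsSmooth u) (hdiv : Torus.IsDivFree u) :
    ∫ x, ∑ a, ∑ b, M a b x * ((Torus.partialDeriv b u x a + Torus.partialDeriv a u x b) / 2) = 0 := by
  rw [← Torus.integral_sum_strainProjection_mul_symGrad_eq hM hu hdiv]
  simp_rw [Torus.strainProjection_eq_zero_of_strainDiv_eq_zero h0]
  simp

/-- **`L²_{Hess} ⊕ L²_{divfree} ⊆ ker P_{st}`, torus form**: if `div_{sym}M = ∇φ` for some smooth
`φ` (e.g. `M` a Hessian, `div Hess f = ∇Δf`, or `M` divergence free, `φ = 0`), then `z_M = 0`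
(`Δ⁻¹∇φ = ∇Δ⁻¹φ` and `Δ⁻²div∇φ = Δ⁻²Δφ = Δ⁻¹φ`, so `z_M = 2∇Δ⁻¹φ − 2∇Δ⁻¹φ = 0`).
[cite: MillerSawyer2023, Cor 1.6] -/
theorem _root_.Literature.Analysis.FluidPDE.Torus.strainPotential_eq_zero_of_strainDiv_eq_gradient
    [Nonempty d] {φ : UnitAddTorus d → ℝ} (hφ : Torus.IsSmooth φ)
    (hsd : ∀ b y, Torus.strainDiv M b y = Torus.partialDeriv b φ y) (y : UnitAddTorus d) :
    Torus.strainPotential M y = 0 := by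
  have e1 : ∀ b, Torus.strainDiv M b = Torus.partialDeriv b φ := fun b => funext fun z => hsd b z
  have e2 : Torus.strainDivDiv M = Torus.laplacian φ := by
    funext z
    show ∑ b, Torus.partialDeriv b (Torus.strainDiv M b) z = _
    simp_rw [e1]
    exact (Torus.laplacian_eq_sum_partialDeriv_partialDeriv hφ z).symm
  have hIφ : Torus.IsSmooth (Torus.invLaplacian φ) := Torus.isSmooth_invLaplacian hφ
  have e3 : Torus.invLaplacian (Torus.strainDivDiv M) = Torus.laplacian (Torus.invLaplacian φ) := by
    rw [e2]; funext z
    rw [Torus.invLaplacian_laplacian hφ z, Torus.laplacian_invLaplacian hφ z]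
  have e4 : Torus.invLaplacian (Torus.invLaplacian (Torus.strainDivDiv M)) = Torus.invLaplacian φ := by
    rw [e3]; funext z
    rw [Torus.invLaplacian_laplacian hIφ z, Torus.integral_invLaplacian hφ, sub_zero]
  ext b
  rw [Torus.strainPotential_apply, e1, e4, ← Torus.partialDeriv_invLaplacian hφ b y]
  simp

/-- `P_{st}M = 0` when `div_{sym}M` is a gradient. [cite: MillerSawyer2023, Cor 1.6] -/
theorem _root_.Literature.Analysis.FluidPDE.Torus.strainProjection_eq_zero_of_strainDiv_eq_gradient
    [Nonempty d] {φ : UnitAddTorus d → ℝ} (hφ : Torus.IsSmooth φ)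
    (hsd : ∀ b y, Torus.strainDiv M b y = Torus.partialDeriv b φ y) (a b : d) (x : UnitAddTorus d) :
    Torus.strainProjection M a b x = 0 := by
  have hz : Torus.strainPotential M = fun _ => 0 :=
    funext fun y => Torus.strainPotential_eq_zero_of_strainDiv_eq_gradient hφ hsd y
  simp only [Torus.strainProjection, hz, partialDeriv_const']
  simp

/-- **Miller–Sawyer, Cor 1.6 on `T^d` — the kernel of the strain projection**:
`(L²_{st})^⊥ = L²_{Hess} ⊕ L²_{divfree}`, here for smooth matrix fields on the torus in the form
"`P_{st}M = 0` iff `div(sym M)` is a gradient": `(∀ a b x, (P_{st}M)_{ab}(x) = 0) ↔ ∃ φ smooth,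
div_{sym}M = ∇φ` (then necessarily `∇φ = ∇Δ⁻¹div div sym M`, by (1.47)). Hessians (`div Hess f = ∇Δf`)
and divergence-free fields (`φ = 0`) are the two printed summands; conversely `sym M − Hess(Δ⁻²div div sym M)`
is divergence free when `P_{st}M = 0` (`Torus.strainDiv_symm_sub_hessian_sub_strainProjection`).
[cite: MillerSawyer2023, Cor 1.6 and Thm 2.3] -/
theorem _root_.Literature.Analysis.FluidPDE.Torus.strainProjection_eq_zero_iff_exists_gradient
    [Nonempty d] (hM : ∀ a b, Torus.IsSmooth (M a b)) :
    (∀ a b x, Torus.strainProjection M a b x = 0) ↔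
      ∃ φ : UnitAddTorus d → ℝ, Torus.IsSmooth φ ∧
        ∀ b y, Torus.strainDiv M b y = Torus.partialDeriv b φ y := by
  constructor
  · intro hP
    refine ⟨Torus.invLaplacian (Torus.strainDivDiv M),
      Torus.isSmooth_invLaplacian (Torus.isSmooth_strainDivDiv hM), fun b y => ?_⟩
    have h := Torus.strainDiv_strainProjection hM b y
    have hP' : Torus.strainProjection M = fun _ _ _ => 0 := by
      funext a c z; exact hP a c z
    rw [hP'] at h
    have h0 : Torus.strainDiv (fun (_ : d) (_ : d) (_ : UnitAddTorus d) => (0 : ℝ)) b y = 0 := by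
      simp [Torus.strainDiv, Torus.partialDeriv, Torus.lineDeriv]
    rw [h0] at h
    linarith
  · rintro ⟨φ, hφ, hsd⟩ a b x
    exact Torus.strainProjection_eq_zero_of_strainDiv_eq_gradient hφ hsd a b x

/-- `div_{sym}` is additive: `div_{sym}(A − B) = div_{sym}A − div_{sym}B` for smooth matrix fields. [folklore] -/
private theorem strainDiv_sub {A B : d → d → UnitAddTorus d → ℝ} (hA : ∀ a b, Torus.IsSmooth (A a b))
    (hB : ∀ a b, Torus.IsSmooth (B a b)) (b : d) (y : UnitAddTorus d) :
    Torus.strainDiv (fun a c z => A a c z - B a c z) b y = Torus.strainDiv A b y - Torus.strainDiv B b y := by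
  have e : ∀ c, (fun z => ((A c b z - B c b z) + (A b c z - B b c z)) / 2) =
      fun z => (fun z => (A c b z + A b c z) / 2) z - (fun z => (B c b z + B b c z) / 2) z := by
    intro c; funext z; simp only; ring
  show ∑ c, Torus.partialDeriv c (fun z => ((A c b z - B c b z) + (A b c z - B b c z)) / 2) y =
    ∑ c, Torus.partialDeriv c (fun z => (A c b z + A b c z) / 2) y -
      ∑ c, Torus.partialDeriv c (fun z => (B c b z + B b c z) / 2) y
  rw [← Finset.sum_sub_distrib]
  refine Finset.sum_congr rfl fun c _ => ?_
  rw [e c, partialDeriv_sub' ((isSmooth_symm hA c b).isContDiff (by simp))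
    ((isSmooth_symm hB c b).isContDiff (by simp))]

/-- `div_{sym}` of a Hessian: `div_{sym}(Hess ψ)_b = ∂_b Δψ`. [folklore] -/
private theorem strainDiv_hessian {ψ : UnitAddTorus d → ℝ} (hψ : Torus.IsSmooth ψ) (b : d)
    (y : UnitAddTorus d) :
    Torus.strainDiv (fun a c z => Torus.partialDeriv a (Torus.partialDeriv c ψ) z) b y =
      Torus.partialDeriv b (Torus.laplacian ψ) y := by
  have e : ∀ c, (fun z => (Torus.partialDeriv c (Torus.partialDeriv b ψ) z +
      Torus.partialDeriv b (Torus.partialDeriv c ψ) z) / 2) = Torus.partialDeriv c (Torus.partialDeriv b ψ) := by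
    intro c; funext z
    rw [Torus.partialDeriv_comm hψ b c z]; ring
  show ∑ c, Torus.partialDeriv c (fun z => (Torus.partialDeriv c (Torus.partialDeriv b ψ) z +
      Torus.partialDeriv b (Torus.partialDeriv c ψ) z) / 2) y = _
  simp_rw [e]
  rw [← Torus.laplacian_eq_sum_partialDeriv_partialDeriv (hψ.partialDeriv b) y,
    Torus.partialDeriv_laplacian_comm hψ b y]

/-- `div_{sym}` only sees the symmetric part: `div_{sym}(sym M) = div_{sym}M`. [folklore] -/
private theorem strainDiv_symm (M : d → d → UnitAddTorus d → ℝ) (b : d) (y : UnitAddTorus d) :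
    Torus.strainDiv (fun a c z => (M a c z + M c a z) / 2) b y = Torus.strainDiv M b y := by
  show ∑ c, Torus.partialDeriv c (fun z => ((M c b z + M b c z) / 2 + (M b c z + M c b z) / 2) / 2) y =
    ∑ c, Torus.partialDeriv c (fun z => (M c b z + M b c z) / 2) y
  refine Finset.sum_congr rfl fun c _ => ?_
  congr 1
  funext z
  ring

/-- **Miller–Sawyer, Thm 1.3 = 2.3 on `T^d` — the Helmholtz-type decomposition of a smooth symmetric
matrix field**: `sym M = Hess φ + P_{st}M + Q` with `φ = Δ⁻²(div div sym M)`, `P_{st}M ∈ L²_{st}` a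
strain (`= ∇_{sym}z_M`, `∇·z_M = 0`) and **`Q` divergence free**: for every `b`,
`div_{sym}(sym M − Hess φ − P_{st}M)_b = 0` (`div_{sym}M − ∇Δ Δ⁻²(…) − (div_{sym}M − ∇Δ⁻¹(…)) = 0`).
The three pieces are pairwise `L²`-orthogonal
(`Torus.integral_sum_hessian_mul_strainProjection_eq_zero`,
`Torus.integral_sum_strainProjection_mul_remainder_eq_zero`,
`Torus.integral_sum_hessian_mul_eq_zero_of_strainDiv_eq_zero`): the printed
`L² = L²_{st} ⊕ L²_{Hess} ⊕ L²_{divfree}` (`ℝ³`; `ℝ^d`, `d ≥ 3`, Thm 5.4; for `d = 2` the third summand is `L²_{Ĩd}`, Thm 5.1) read on smooth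
fields over `T^d`, constants being divergence free. [cite: MillerSawyer2023, Thm 1.3, Thm 2.3; Thm 5.1 (d = 2) and Thm 5.4 (general d ≥ 3)] -/
theorem _root_.Literature.Analysis.FluidPDE.Torus.strainDiv_symm_sub_hessian_sub_strainProjection
    [Nonempty d] (hM : ∀ a b, Torus.IsSmooth (M a b)) (b : d) (y : UnitAddTorus d) :
    Torus.strainDiv (fun a c z => (M a c z + M c a z) / 2 -
        Torus.partialDeriv a (Torus.partialDeriv c
          (Torus.invLaplacian (Torus.invLaplacian (Torus.strainDivDiv M)))) z -
        Torus.strainProjection M a c z) b y = 0 := by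
  have hsdd : Torus.IsSmooth (Torus.strainDivDiv M) := Torus.isSmooth_strainDivDiv hM
  have hIg : Torus.IsSmooth (Torus.invLaplacian (Torus.strainDivDiv M)) := Torus.isSmooth_invLaplacian hsdd
  have hψ : Torus.IsSmooth (Torus.invLaplacian (Torus.invLaplacian (Torus.strainDivDiv M))) :=
    Torus.isSmooth_invLaplacian hIg
  have hS : ∀ a c, Torus.IsSmooth (fun z => (M a c z + M c a z) / 2) := fun a c => isSmooth_symm hM a c
  have hH : ∀ a c, Torus.IsSmooth (fun z => Torus.partialDeriv a (Torus.partialDeriv c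
      (Torus.invLaplacian (Torus.invLaplacian (Torus.strainDivDiv M)))) z) :=
    fun a c => (hψ.partialDeriv c).partialDeriv a
  have hP : ∀ a c, Torus.IsSmooth (Torus.strainProjection M a c) := fun a c =>
    Torus.isSmooth_strainProjection hM a c
  have hSH : ∀ a c, Torus.IsSmooth (fun z => (M a c z + M c a z) / 2 -
      Torus.partialDeriv a (Torus.partialDeriv c
        (Torus.invLaplacian (Torus.invLaplacian (Torus.strainDivDiv M)))) z) :=
    fun a c => (hS a c).sub (hH a c)
  have hΔψ : Torus.laplacian (Torus.invLaplacian (Torus.invLaplacian (Torus.strainDivDiv M))) =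
      Torus.invLaplacian (Torus.strainDivDiv M) := by
    funext z
    rw [Torus.laplacian_invLaplacian hIg z, Torus.integral_invLaplacian hsdd, sub_zero]
  rw [strainDiv_sub hSH hP b y, strainDiv_sub hS hH b y, strainDiv_symm M b y, strainDiv_hessian hψ b y,
    hΔψ, Torus.strainDiv_strainProjection hM b y]
  ring

omit [DecidableEq d] in
/-- Double finite sums of smooth scalar functions are smooth. [folklore] -/
private theorem smooth_sum2 {F : d → d → UnitAddTorus d → ℝ} (hF : ∀ a b, Torus.IsSmooth (F a b)) :
    Torus.IsSmooth (fun x => ∑ a, ∑ b, F a b x) :=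
  isSmooth_sum _ fun a _ => isSmooth_sum _ fun b _ => hF a b

/-- **`L²_{Hess} ⊥ L²_{st}`** on `T^d`: `∫ ∑_{ab} ∂_a∂_bφ · (P_{st}M)_{ab} = 0` for smooth `φ` and `M`
(`P_{st}` is self-adjoint and kills Hessians: tree `Torus.integral_sum_strainProjection_mul_comm`,
`Torus.strainProjection_hessian`; Miller–Sawyer Thm 2.3, orthogonality of the first two summands,
after Miller 2020 Prop 2.4). [cite: MillerSawyer2023, Thm 2.3; Miller2019, Prop 2.4] -/
theorem _root_.Literature.Analysis.FluidPDE.Torus.integral_sum_hessian_mul_strainProjection_eq_zero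
    [Nonempty d] (hM : ∀ a b, Torus.IsSmooth (M a b)) {φ : UnitAddTorus d → ℝ} (hφ : Torus.IsSmooth φ) :
    ∫ x, ∑ a, ∑ b, Torus.partialDeriv a (Torus.partialDeriv b φ) x * Torus.strainProjection M a b x = 0 := by
  have hH : ∀ a b, Torus.IsSmooth (fun y => Torus.partialDeriv a (Torus.partialDeriv b φ) y) :=
    fun a b => (hφ.partialDeriv b).partialDeriv a
  have h := Torus.integral_sum_strainProjection_mul_comm
    (M := fun a b y => Torus.partialDeriv a (Torus.partialDeriv b φ) y) (N := M) hH hM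
  rw [← h]
  simp_rw [Torus.strainProjection_hessian hφ]
  simp

/-- **`P_{st}M ⊥ Q`**, `Q = sym M − Hess φ − P_{st}M` the divergence-free remainder of the decomposition
(`φ = Δ⁻²div div sym M`): `⟨P_{st}M, sym M⟩ = ⟨P_{st}M, M⟩ = ‖P_{st}M‖²` and `⟨P_{st}M, Hess φ⟩ = 0`.
[cite: MillerSawyer2023, Thm 2.3] -/
theorem _root_.Literature.Analysis.FluidPDE.Torus.integral_sum_strainProjection_mul_remainder_eq_zero
    [Nonempty d] (hM : ∀ a b, Torus.IsSmooth (M a b)) :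
    ∫ x, ∑ a, ∑ b, Torus.strainProjection M a b x *
        ((M a b x + M b a x) / 2 -
          Torus.partialDeriv a (Torus.partialDeriv b
            (Torus.invLaplacian (Torus.invLaplacian (Torus.strainDivDiv M)))) x -
          Torus.strainProjection M a b x) = 0 := by
  set ψ : UnitAddTorus d → ℝ := Torus.invLaplacian (Torus.invLaplacian (Torus.strainDivDiv M)) with hψdef
  have hψ : Torus.IsSmooth ψ :=
    Torus.isSmooth_invLaplacian (Torus.isSmooth_invLaplacian (Torus.isSmooth_strainDivDiv hM))
  have hP : ∀ a b, Torus.IsSmooth (Torus.strainProjection M a b) := fun a b =>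
    Torus.isSmooth_strainProjection hM a b
  have hH : ∀ a b, Torus.IsSmooth (fun y => Torus.partialDeriv a (Torus.partialDeriv b ψ) y) :=
    fun a b => (hψ.partialDeriv b).partialDeriv a
  -- split the integrand
  have hpt : ∀ x, ∑ a, ∑ b, Torus.strainProjection M a b x *
      ((M a b x + M b a x) / 2 - Torus.partialDeriv a (Torus.partialDeriv b ψ) x -
        Torus.strainProjection M a b x) =
      (∑ a, ∑ b, Torus.strainProjection M a b x * ((M a b x + M b a x) / 2)) -
        (∑ a, ∑ b, Torus.partialDeriv a (Torus.partialDeriv b ψ) x * Torus.strainProjection M a b x) -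
        ∑ a, ∑ b, Torus.strainProjection M a b x ^ 2 := by
    intro x
    simp only [← Finset.sum_sub_distrib]
    refine Finset.sum_congr rfl fun a _ => Finset.sum_congr rfl fun b _ => ?_
    ring
  -- `⟨P, sym M⟩ = ⟨M, P⟩` pointwise in the sum (symmetry of `P_{st}M`)
  have hsym : ∀ x, ∑ a, ∑ b, Torus.strainProjection M a b x * ((M a b x + M b a x) / 2) =
      ∑ a, ∑ b, M a b x * Torus.strainProjection M a b x := by
    intro x
    have h1 : ∑ a, ∑ b, Torus.strainProjection M a b x * M b a x =
        ∑ a, ∑ b, Torus.strainProjection M a b x * M a b x := by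
      rw [Finset.sum_comm]
      exact Finset.sum_congr rfl fun a _ => Finset.sum_congr rfl fun b _ => by
        rw [Torus.strainProjection_comm M b a x]
    have h2 : ∑ a, ∑ b, Torus.strainProjection M a b x * ((M a b x + M b a x) / 2) =
        2⁻¹ * (∑ a, ∑ b, Torus.strainProjection M a b x * M a b x) +
          2⁻¹ * ∑ a, ∑ b, Torus.strainProjection M a b x * M b a x := by
      simp only [Finset.mul_sum, ← Finset.sum_add_distrib]
      exact Finset.sum_congr rfl fun a _ => Finset.sum_congr rfl fun b _ => by ring
    rw [h2, h1, ← two_mul, ← mul_assoc, mul_inv_cancel₀ (two_ne_zero), one_mul]  -- careful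
    exact Finset.sum_congr rfl fun a _ => Finset.sum_congr rfl fun b _ => mul_comm _ _
  simp_rw [hpt]
  have hI1 : Integrable (fun x => ∑ a, ∑ b, Torus.strainProjection M a b x * ((M a b x + M b a x) / 2)) volume :=
    (smooth_sum2 fun a b => smooth_mul (hP a b) (isSmooth_symm hM a b)).integrable
  have hI2 : Integrable (fun x => ∑ a, ∑ b,
      Torus.partialDeriv a (Torus.partialDeriv b ψ) x * Torus.strainProjection M a b x) volume :=
    (smooth_sum2 fun a b => smooth_mul (hH a b) (hP a b)).integrable
  have hI3 : Integrable (fun x => ∑ a, ∑ b, Torus.strainProjection M a b x ^ 2) volume :=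
    (smooth_sum2 fun a b => smooth_sq (hP a b)).integrable
  have hI12 : Integrable (fun x => (∑ a, ∑ b, Torus.strainProjection M a b x * ((M a b x + M b a x) / 2)) -
      ∑ a, ∑ b, Torus.partialDeriv a (Torus.partialDeriv b ψ) x * Torus.strainProjection M a b x) volume :=
    hI1.sub hI2
  rw [integral_sub hI12 hI3, integral_sub hI1 hI2]
  simp_rw [hsym]
  rw [Torus.integral_sum_hessian_mul_strainProjection_eq_zero hM hψ,
    ← Torus.integral_sum_strainProjection_sq_eq hM]
  ring

/-- **Miller–Sawyer, Prop 2.11 on `T^d` — `(L²_{Hess})^⊥ = ker(div²)`, as the identity behind it**: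
`⟨Hess φ, Q⟩ = ∫ φ · div div (sym Q)` for smooth `φ` and a smooth matrix field `Q`
("integrating by parts twice, `⟨Hess(−Δ)⁻¹f, M⟩ = ⟨f, div²(−Δ)⁻¹M⟩`"), i.e.
`∫ ∑_{ab} ∂_a∂_bφ · Q_{ab} = ∫ φ · (div div sym Q)`. [cite: MillerSawyer2023, Prop 2.11 (proof)] -/
theorem _root_.Literature.Analysis.FluidPDE.Torus.integral_sum_hessian_mul_eq_integral_mul_strainDivDiv
    {Q : d → d → UnitAddTorus d → ℝ} (hQ : ∀ a b, Torus.IsSmooth (Q a b)) {φ : UnitAddTorus d → ℝ}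
    (hφ : Torus.IsSmooth φ) :
    ∫ x, ∑ a, ∑ b, Torus.partialDeriv a (Torus.partialDeriv b φ) x * Q a b x =
      ∫ x, φ x * Torus.strainDivDiv Q x := by
  have hSQ : ∀ a b, Torus.IsSmooth (fun z => (Q a b z + Q b a z) / 2) := fun a b => isSmooth_symm hQ a b
  have hsd : ∀ b, Torus.IsSmooth (Torus.strainDiv Q b) := fun b => Torus.isSmooth_strainDiv hQ b
  have hH : ∀ a b, Torus.IsSmooth (Torus.partialDeriv a (Torus.partialDeriv b φ)) :=
    fun a b => (hφ.partialDeriv b).partialDeriv a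
  -- Step 1: symmetrise `Q` against the symmetric Hessian
  have hsym : ∀ x, ∑ a, ∑ b, Torus.partialDeriv a (Torus.partialDeriv b φ) x * Q a b x =
      ∑ a, ∑ b, Torus.partialDeriv a (Torus.partialDeriv b φ) x * ((Q a b x + Q b a x) / 2) := by
    intro x
    have h1 : ∑ a, ∑ b, Torus.partialDeriv a (Torus.partialDeriv b φ) x * Q b a x =
        ∑ a, ∑ b, Torus.partialDeriv a (Torus.partialDeriv b φ) x * Q a b x := by
      rw [Finset.sum_comm]
      exact Finset.sum_congr rfl fun a _ => Finset.sum_congr rfl fun b _ => by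
        rw [Torus.partialDeriv_comm hφ a b x]
    have h2 : ∑ a, ∑ b, Torus.partialDeriv a (Torus.partialDeriv b φ) x * ((Q a b x + Q b a x) / 2) =
        2⁻¹ * (∑ a, ∑ b, Torus.partialDeriv a (Torus.partialDeriv b φ) x * Q a b x) +
          2⁻¹ * ∑ a, ∑ b, Torus.partialDeriv a (Torus.partialDeriv b φ) x * Q b a x := by
      simp only [Finset.mul_sum, ← Finset.sum_add_distrib]
      exact Finset.sum_congr rfl fun a _ => Finset.sum_congr rfl fun b _ => by ring
    rw [h2, h1]; ring
  simp_rw [hsym]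
  -- Step 2: `∫ ∑_a ∑_b ∂_a∂_bφ · Sq_{ab} = −∑_b ∫ ∂_bφ · (div_{sym}Q)_b`
  rw [integral_finsetSum _ fun a _ =>
      (isSmooth_sum _ fun b _ => smooth_mul (hH a b) (hSQ a b)).integrable]
  have hrow : ∀ a, ∫ x, ∑ b, Torus.partialDeriv a (Torus.partialDeriv b φ) x * ((Q a b x + Q b a x) / 2) =
      ∑ b, -∫ x, Torus.partialDeriv b φ x * Torus.partialDeriv a (fun z => (Q a b z + Q b a z) / 2) x := by
    intro a
    rw [integral_finsetSum _ fun b _ => (smooth_mul (hH a b) (hSQ a b)).integrable]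
    refine Finset.sum_congr rfl fun b _ => ?_
    exact integral_partialDeriv_mul_eq_neg (hφ.partialDeriv b) (hSQ a b) a
  simp_rw [hrow]
  rw [Finset.sum_comm]
  -- Step 3: collect `∑_a ∂_bφ ∂_a Sq_{ab} = ∂_bφ · (div_{sym}Q)_b` and integrate by parts once more
  have hcol : ∀ b, ∑ a, -∫ x, Torus.partialDeriv b φ x *
      Torus.partialDeriv a (fun z => (Q a b z + Q b a z) / 2) x =
      ∫ x, φ x * Torus.partialDeriv b (Torus.strainDiv Q b) x := by
    intro b
    rw [Finset.sum_neg_distrib,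
      ← integral_finsetSum _ fun a _ => (smooth_mul (hφ.partialDeriv b) ((hSQ a b).partialDeriv a)).integrable]
    have e : ∀ x, ∑ a, Torus.partialDeriv b φ x * Torus.partialDeriv a (fun z => (Q a b z + Q b a z) / 2) x =
        Torus.partialDeriv b φ x * Torus.strainDiv Q b x := by
      intro x
      rw [← Finset.mul_sum]
      rfl
    simp_rw [e]
    rw [integral_partialDeriv_mul_eq_neg hφ (hsd b) b, neg_neg]
  simp_rw [hcol]
  rw [← integral_finsetSum _ fun b _ => (smooth_mul hφ ((hsd b).partialDeriv b)).integrable]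
  refine integral_congr_ae (Filter.Eventually.of_forall fun x => ?_)
  simp only [← Finset.mul_sum]
  rfl

/-- **`L²_{Hess} ⊥ ker(div)`**: a smooth matrix field `Q` with `div_{sym}Q = 0` is `L²`-orthogonal to
every Hessian, `∫ ∑_{ab} ∂_a∂_bφ · Q_{ab} = 0` (Prop 2.11: `ker(div) ⊆ ker(div²) = (L²_{Hess})^⊥`). In
particular the remainder `Q` of `Torus.strainDiv_symm_sub_hessian_sub_strainProjection` is orthogonal
to `Hess φ`, completing the pairwise orthogonality of the three summands.
[cite: MillerSawyer2023, Prop 2.11 and Thm 2.3] -/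
theorem _root_.Literature.Analysis.FluidPDE.Torus.integral_sum_hessian_mul_eq_zero_of_strainDiv_eq_zero
    {Q : d → d → UnitAddTorus d → ℝ} (hQ : ∀ a b, Torus.IsSmooth (Q a b))
    (h0 : ∀ b y, Torus.strainDiv Q b y = 0) {φ : UnitAddTorus d → ℝ} (hφ : Torus.IsSmooth φ) :
    ∫ x, ∑ a, ∑ b, Torus.partialDeriv a (Torus.partialDeriv b φ) x * Q a b x = 0 := by
  rw [Torus.integral_sum_hessian_mul_eq_integral_mul_strainDivDiv hQ hφ]
  have e1 : ∀ b, Torus.strainDiv Q b = 0 := fun b => funext fun z => h0 b z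
  have e2 : ∀ x, Torus.strainDivDiv Q x = 0 := by
    intro x
    show ∑ b, Torus.partialDeriv b (Torus.strainDiv Q b) x = 0
    simp_rw [e1]
    exact Finset.sum_eq_zero fun b _ => by simp [Torus.partialDeriv, Torus.lineDeriv]
  simp_rw [e2]
  simp

/-! ### §4 Axial compression with planar stretching in a fixed frame (Miller–Sawyer, Thm 1.17) -/

omit [Fintype d] in
/-- `C = I − 3v⊗v` is symmetric. [folklore] -/
private theorem axial_symm (v : d → ℝ) (a b : d) :
    ((if a = b then (1 : ℝ) else 0) - 3 * v a * v b) = ((if b = a then (1 : ℝ) else 0) - 3 * v b * v a) := by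
  by_cases h : a = b
  · subst h; ring
  · rw [if_neg h, if_neg (Ne.symm h)]; ring

/-- `∑_c (δ_{bc} − 3v_bv_c)κ_c = κ_b − 3v_b(v·κ)`. [folklore] -/
private theorem axial_apply (v κ : d → ℝ) (b : d) :
    ∑ c, ((if b = c then (1 : ℝ) else 0) - 3 * v b * v c) * κ c = κ b - 3 * v b * ∑ c, v c * κ c := by
  have e : ∀ c, ((if b = c then (1 : ℝ) else 0) - 3 * v b * v c) * κ c =
      (if b = c then κ c else 0) - 3 * v b * (v c * κ c) := by
    intro c; split_ifs <;> ring
  simp_rw [e]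
  rw [Finset.sum_sub_distrib, Finset.sum_ite_eq, ← Finset.mul_sum]
  simp

/-- `κᵀ(I − 3v⊗v)κ = |κ|² − 3(v·κ)²`. [folklore] -/
private theorem axial_quad (v κ : d → ℝ) :
    ∑ e, ∑ c, κ e * ((if e = c then (1 : ℝ) else 0) - 3 * v e * v c) * κ c =
      (∑ a, κ a ^ 2) - 3 * (∑ c, v c * κ c) ^ 2 := by
  have e1 : ∀ e, ∑ c, κ e * ((if e = c then (1 : ℝ) else 0) - 3 * v e * v c) * κ c =
      κ e * ∑ c, ((if e = c then (1 : ℝ) else 0) - 3 * v e * v c) * κ c := by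
    intro e; rw [Finset.mul_sum]; exact Finset.sum_congr rfl fun c _ => by ring
  simp_rw [e1, axial_apply]
  have e2 : ∀ e, κ e * (κ e - 3 * v e * ∑ c, v c * κ c) =
      κ e ^ 2 - 3 * (∑ c, v c * κ c) * (v e * κ e) := by intro e; ring
  simp_rw [e2]
  rw [Finset.sum_sub_distrib, ← Finset.mul_sum]
  ring

/-- **The symbol bound**: for a real unit vector `v`, a nonzero real frequency `κ` (`K = |κ|²`,
`t = v·κ`) and `w = (I − 3v⊗v)κ − (κᵀ(I − 3v⊗v)κ/K)κ = −3t(v − (t/K)κ)`: `κ·w = 0`,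
`|w|² = 9t²(1 − t²/K)` and `∑_{ab}((κ_a w_b + κ_b w_a)/K)² = 18t²(K − t²)/K² ≤ 9/2`
(equality iff `t² = K/2`). [cite: MillerSawyer2023, Thm 1.17 (proof, §3)] -/
private theorem symbol_sq_sum_le (v κ : d → ℝ) (hv : ∑ a, v a ^ 2 = 1) {K : ℝ}
    (hKdef : ∑ a, κ a ^ 2 = K) (hK : 0 < K) (C : d → d → ℝ)
    (hC : ∀ e c, C e c = (if e = c then (1 : ℝ) else 0) - 3 * v e * v c)
    (X : d → ℝ) (hX : ∀ b, X b = ∑ c, C b c * κ c) (Y : ℝ) (hY : Y = ∑ e, ∑ c, κ e * C e c * κ c)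
    (w : d → ℝ) (hw : ∀ b, w b = X b - Y / K * κ b) :
    ∑ a, ∑ b, ((κ a * w b + κ b * w a) / K) ^ 2 ≤ 9 / 2 := by
  obtain ⟨t, ht⟩ : ∃ t : ℝ, ∑ c, v c * κ c = t := ⟨_, rfl⟩
  have hK0 : K ≠ 0 := hK.ne'
  have hX' : ∀ b, X b = κ b - 3 * v b * t := by
    intro b
    rw [hX b]
    simp_rw [hC]
    rw [axial_apply, ht]
  have hY' : Y = K - 3 * t ^ 2 := by
    rw [hY]
    simp_rw [hC]
    rw [axial_quad, ht, hKdef]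
  have hw' : ∀ b, w b = -3 * t * (v b - t / K * κ b) := by
    intro b
    rw [hw b, hX', hY']
    field_simp
    ring
  have hT : ∑ a, κ a * w a = 0 := by
    have h1 : ∀ a, κ a * w a = -3 * t * (v a * κ a) + 3 * t * (t / K) * κ a ^ 2 := by
      intro a; rw [hw']; ring
    simp_rw [h1]
    rw [Finset.sum_add_distrib, ← Finset.mul_sum, ← Finset.mul_sum, ht, hKdef]
    field_simp
    ring
  have hW : ∑ b, w b ^ 2 = 9 * t ^ 2 * (1 - t ^ 2 / K) := by
    have h2 : ∀ b, w b ^ 2 = 9 * t ^ 2 * v b ^ 2 - 18 * t ^ 2 * (t / K) * (v b * κ b) +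
        9 * t ^ 2 * (t / K) ^ 2 * κ b ^ 2 := by
      intro b; rw [hw']; ring
    simp_rw [h2]
    rw [Finset.sum_add_distrib, Finset.sum_sub_distrib, ← Finset.mul_sum, ← Finset.mul_sum,
      ← Finset.mul_sum, hv, ht, hKdef]
    field_simp
    ring
  have hS : ∑ a, ∑ b, (κ a * w b + κ b * w a) ^ 2 =
      2 * K * (∑ b, w b ^ 2) + 2 * (∑ a, κ a * w a) ^ 2 := by
    have e : ∀ a b, (κ a * w b + κ b * w a) ^ 2 =
        κ a ^ 2 * w b ^ 2 + w a ^ 2 * κ b ^ 2 + (2 * (κ a * w a)) * (κ b * w b) := fun a b => by ring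
    simp_rw [e, Finset.sum_add_distrib]
    rw [← Finset.sum_mul_sum, ← Finset.sum_mul_sum, ← Finset.sum_mul_sum, ← Finset.mul_sum, hKdef]
    ring
  have hdiv : ∑ a, ∑ b, ((κ a * w b + κ b * w a) / K) ^ 2 =
      (∑ a, ∑ b, (κ a * w b + κ b * w a) ^ 2) / K ^ 2 := by
    simp_rw [div_pow]
    rw [Finset.sum_div]
    refine Finset.sum_congr rfl fun a _ => ?_
    rw [Finset.sum_div]
  rw [hdiv, hS, hT, hW, div_le_iff₀ (pow_pos hK 2)]
  have key : 2 * K * (9 * t ^ 2 * (1 - t ^ 2 / K)) + 2 * (0 : ℝ) ^ 2 =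
      9 / 2 * K ^ 2 - 9 / 2 * (K - 2 * t ^ 2) ^ 2 := by
    field_simp
    ring
  rw [key]
  nlinarith [sq_nonneg (K - 2 * t ^ 2), pow_pos hK 2]

/-- **Miller–Sawyer, Thm 1.17 on `T^d` — axial compression along a FIXED axis with planar stretching
keeps at most three quarters of its `L²` mass inside the strain space.** For a unit vector `v ∈ ℝ^d`
(`∑ v_a² = 1`) and a smooth real amplitude `λ` on `T^d`,
`‖P_{st}(λ(I − 3v⊗v))‖²_{L²} ≤ (9/2)‖λ‖²_{L²}`; for `card d = 3`, where `|I₃ − 3v⊗v|² = 6`, this is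
the printed `‖P_{st}(λ(I₃ − 3v⊗v)/√6)‖²_{L²} ≤ ¾‖λ‖²_{L²}` (the source states and proves `d = 3` only;
the same constant `9/2` for `card d ≠ 3` is [ours] — the mode-by-mode computation below does not see
the dimension) — the value `¾` of the supremum in Thm 1.17,
display (1.42) (on `ℝ³` a supremum that is not attained; near-maximisers have `supp λ̂` near the cone
`ξ_v² = |ξ|²/2`, (1.43)). PROOF = the printed Fourier computation, mode by mode on `ℤ^d`: by
`Torus.mFourierCoeff_strainProjection_of_symm`, `𝓕(P_{st}(λC))(k) = λ̂(k)(k⊗w + w⊗k)/|k|²` with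
`w = Ck − (kᵀCk/|k|²)k = −3t(v − (t/|k|²)k)`, `t = v·k`, so
`∑_{ab}|𝓕(P_{st}(λC))_{ab}(k)|² = 18|λ̂(k)|² s(1 − s)`, `s = (v·k)²/|k|² ∈ [0,1]`, `≤ (9/2)|λ̂(k)|²`
(`SymmetricHelmholtz.symbol_sq_sum_le`), and Parseval on both sides
(`Torus.hasSum_sq_mFourierCoeff_strainProjection`, `Torus.hasSum_sq_mFourierCoeff_ofReal`). TORUS
REMARK [ours]: on `T³` the bound is ATTAINED by single Fourier modes on the cone `(v·k)² = |k|²/2`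
(e.g. `v = e₃`, `k = (3,4,5)`), where `s = ½`. [cite: MillerSawyer2023, Thm 1.17 and display (1.42); Thm 3.2 (proof)] -/
theorem _root_.Literature.Analysis.FluidPDE.Torus.integral_sum_strainProjection_axial_sq_le [Nonempty d]
    (v : d → ℝ) (hv : ∑ a, v a ^ 2 = 1) {lam : UnitAddTorus d → ℝ} (hlam : Torus.IsSmooth lam) :
    ∫ x, ∑ a, ∑ b, Torus.strainProjection
        (fun a b y => lam y * ((if a = b then (1 : ℝ) else 0) - 3 * v a * v b)) a b x ^ 2 ≤
      9 / 2 * ∫ x, lam x ^ 2 := by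
  obtain ⟨C, hC⟩ : ∃ C : d → d → ℝ, ∀ e c, C e c = (if e = c then (1 : ℝ) else 0) - 3 * v e * v c :=
    ⟨_, fun _ _ => rfl⟩
  have hfunA : (fun a b y => lam y * ((if a = b then (1 : ℝ) else 0) - 3 * v a * v b)) =
      fun a b y => lam y * C a b := by
    funext a b y; rw [hC]
  rw [hfunA]
  set A : d → d → UnitAddTorus d → ℝ := fun a b y => lam y * C a b with hAdef
  have hA : ∀ a b, Torus.IsSmooth (A a b) := fun a b => hlam.mul (Torus.isSmooth_const _)
  have hCsymm : ∀ a b, C a b = C b a := by intro a b; rw [hC, hC, axial_symm v a b]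
  have hsymm : ∀ a b x, A a b x = A b a x := by
    intro a b x
    show lam x * C a b = lam x * C b a
    rw [hCsymm]
  -- Parseval on both sides
  have hPA := Torus.hasSum_sq_mFourierCoeff_strainProjection hA
  have hL := (Torus.hasSum_sq_mFourierCoeff_ofReal hlam.continuous).mul_left (9 / 2)
  have hswap : ∫ x, ∑ a, ∑ b, Torus.strainProjection A a b x ^ 2 =
      ∑ a, ∑ b, ∫ x, Torus.strainProjection A a b x ^ 2 := by
    rw [integral_finsetSum _ fun a _ => (isSmooth_sum _ fun b _ =>
      smooth_sq (Torus.isSmooth_strainProjection hA a b)).integrable]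
    exact Finset.sum_congr rfl fun a _ =>
      integral_finsetSum _ fun b _ => (smooth_sq (Torus.isSmooth_strainProjection hA a b)).integrable
  rw [hswap]
  refine hasSum_le (fun k => ?_) hPA hL
  by_cases hk : k = 0
  · subst hk
    simp_rw [Torus.mFourierCoeff_strainProjection_zero hA]
    simp only [norm_zero, ne_eq, OfNat.ofNat_ne_zero, not_false_eq_true, zero_pow,
      Finset.sum_const_zero]
    positivity
  · -- the symbol at a nonzero frequency
    set L : ℂ := mFourierCoeff (fun x => (lam x : ℂ)) k with hLdef
    have hK1 : 1 ≤ Torus.freqNormSq k := Torus.one_le_freqNormSq_of_ne_zero hk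
    have hK : 0 < Torus.freqNormSq k := by linarith
    have hKdef : ∑ a, ((k a : ℝ)) ^ 2 = Torus.freqNormSq k := rfl
    obtain ⟨X, hX⟩ : ∃ X : d → ℝ, ∀ b, X b = ∑ c, C b c * (k c : ℝ) := ⟨_, fun _ => rfl⟩
    obtain ⟨Y, hY⟩ : ∃ Y : ℝ, Y = ∑ e, ∑ c, (k e : ℝ) * C e c * (k c : ℝ) := ⟨_, rfl⟩
    obtain ⟨w, hw⟩ : ∃ w : d → ℝ, ∀ b, w b = X b - Y / Torus.freqNormSq k * (k b : ℝ) :=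
      ⟨_, fun _ => rfl⟩
    set N : d → d → ℂ := fun e c => L * (C e c : ℂ) with hNdef
    have hN : ∀ e c, N e c = mFourierCoeff (fun x => (A e c x : ℂ)) k := by
      intro e c
      have hfun : (fun x => (A e c x : ℂ)) = (C e c : ℂ) • fun x => (lam x : ℂ) := by
        funext x
        simp only [hAdef, Pi.smul_apply, smul_eq_mul, Complex.ofReal_mul]
        ring
      rw [hfun, Torus.mFourierCoeff_const_smul, smul_eq_mul, hNdef, mul_comm]
    have hXc : ∀ b, ∑ c, N b c * (k c : ℂ) = L * (X b : ℂ) := by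
      intro b
      rw [hX b, Complex.ofReal_sum, Finset.mul_sum]
      refine Finset.sum_congr rfl fun c _ => ?_
      simp only [hNdef, Complex.ofReal_mul, Complex.ofReal_intCast]
      ring
    have hYc : ∑ e, ∑ c, (k e : ℂ) * N e c * (k c : ℂ) = L * (Y : ℂ) := by
      rw [hY, Complex.ofReal_sum, Finset.mul_sum]
      refine Finset.sum_congr rfl fun e _ => ?_
      rw [Complex.ofReal_sum, Finset.mul_sum]
      refine Finset.sum_congr rfl fun c _ => ?_
      simp only [hNdef, Complex.ofReal_mul, Complex.ofReal_intCast]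
      ring
    have hKc : (Torus.freqNormSq k : ℂ) ≠ 0 := by exact_mod_cast hK.ne'
    have hFR : ∀ a b, mFourierCoeff (fun x => ((Torus.strainProjection A a b x : ℝ) : ℂ)) k =
        L * ((((k a : ℝ) * w b + (k b : ℝ) * w a) / Torus.freqNormSq k : ℝ) : ℂ) := by
      intro a b
      rw [Torus.mFourierCoeff_strainProjection_of_symm hA hsymm k N hN a b, hXc, hXc, hYc, hw a, hw b]
      push_cast
      field_simp
    simp_rw [hFR, norm_mul, mul_pow, Complex.norm_real, Real.norm_eq_abs, sq_abs]
    simp_rw [← Finset.mul_sum]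
    have hR := symbol_sq_sum_le v (fun a => (k a : ℝ)) hv hKdef hK C hC X hX Y hY w hw
    calc ‖L‖ ^ 2 * ∑ a, ∑ b, (((k a : ℝ) * w b + (k b : ℝ) * w a) / Torus.freqNormSq k) ^ 2
        ≤ ‖L‖ ^ 2 * (9 / 2) := mul_le_mul_of_nonneg_left hR (sq_nonneg _)
      _ = 9 / 2 * ‖L‖ ^ 2 := mul_comm _ _

/-! ### §5 The compression axis of a max-mid strain cannot omit a direction
(Miller–Sawyer, Thm 1.18 = Thm 3.4) -/

/-- **Miller–Sawyer Thm 1.18 (= Thm 3.4), torus form.** Printed (`ℝ³`): if `|v(x)| = 1` and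
`v₁(x) = 0` almost everywhere (the axis of compression varies in space but is confined to the
`yz`-plane), then there is no `λ ∈ L²`, `λ ≥ 0`, `λ ≢ 0`, with `λ(I₃ − 3v⊗v) ∈ L²_{st}` — "any
nontrivial maxmid matrix in the strain constraint space must compress in all three directions; the
axis of compression cannot be confined to any fixed plane". Here on `T^d` (any finite `d`), smooth
setting: if `u` is smooth with strain `S_{ab}(x) = ½((∂_b u)_a + (∂_a u)_b)(x) = λ(x)(δ_{ab} − 3v_a(x)v_b(x))`
for a continuous `λ ≥ 0` and a direction field `v` whose `a₀`-th component vanishes identically, then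
`λ ≡ 0`. Proof as printed up to the last step: the `(a₀, a₀)` entry reads `∂_{a₀}u_{a₀} = λ`
(printed `∂₁u₁ = λ`); on the torus a diagonal strain entry has zero mean
(`Torus.integral_symGrad_eq_zero`), so `∫λ = 0` and `λ ≥ 0` forces `λ ≡ 0` (on `ℝ³` the paper
concludes from `u₁ ∈ L⁶ ⊂ Ḣ¹` instead). The printed hypotheses `|v| = 1` and `∇·u = 0` are not
used by this implication on `T^d` [ours]. [cite: MillerSawyer2023, Thm 1.18 = Thm 3.4 with proof] -/
theorem _root_.Literature.Analysis.FluidPDE.Torus.eq_zero_of_symGrad_eq_axial_of_axis_apply_eq_zero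
    {u : UnitAddTorus d → EuclideanSpace ℝ d} (hu : Torus.IsSmooth u)
    {lam : UnitAddTorus d → ℝ} (hlam : Continuous lam) (hlam0 : ∀ x, 0 ≤ lam x)
    {v : d → UnitAddTorus d → ℝ} {a₀ : d} (hv : ∀ x, v a₀ x = 0)
    (hS : ∀ a b x, (Torus.partialDeriv b u x a + Torus.partialDeriv a u x b) / 2 =
      lam x * ((if a = b then (1 : ℝ) else 0) - 3 * v a x * v b x)) (x : UnitAddTorus d) :
    lam x = 0 := by
  have h1 : ∀ y, (Torus.partialDeriv a₀ u y a₀ + Torus.partialDeriv a₀ u y a₀) / 2 = lam y := by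
    intro y
    rw [hS a₀ a₀ y, if_pos rfl, hv y]
    ring
  have h2 : ∫ y, lam y = 0 := by
    rw [← Torus.integral_symGrad_eq_zero hu a₀ a₀]
    exact integral_congr_ae (Filter.Eventually.of_forall fun y => (h1 y).symm)
  have hae := (integral_eq_zero_iff_of_nonneg (f := lam) (fun y => hlam0 y)
    hlam.integrable_unitAddTorus).1 h2
  have hzero := (Continuous.ae_eq_iff_eq volume hlam continuous_const).1 hae
  exact congrFun hzero x

/-! ### §6 The rank-one reduction (Miller–Sawyer, Prop 3.7) -/

/-- **The identity behind Miller–Sawyer Prop 3.7**: for smooth real `λ` and a smooth vector field of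
components `v_a` on `T^d`, `P_{st}(λ(I − 3v⊗v)) = −3 P_{st}(λ v⊗v)` — `P_{st}` is linear and kills
multiples of the identity (proof of Prop 3.7: "`P_{st}(λ(I₃ − 3v⊗v)/√6) = −(3/√6)P_{st}(√λv⊗√λv)`";
here without the normalisation `|v| = 1`, `λ ≥ 0`, which that display does not use).
[cite: MillerSawyer2023, Prop 3.7 (proof, second display)] -/
theorem _root_.Literature.Analysis.FluidPDE.Torus.strainProjection_smul_id_sub_three_outer [Nonempty d]
    {lam : UnitAddTorus d → ℝ} (hlam : Torus.IsSmooth lam) {v : d → UnitAddTorus d → ℝ}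
    (hv : ∀ a, Torus.IsSmooth (v a)) (a b : d) (x : UnitAddTorus d) :
    Torus.strainProjection
        (fun a b y => lam y * ((if a = b then (1 : ℝ) else 0) - 3 * v a y * v b y)) a b x =
      -3 * Torus.strainProjection (fun a b y => lam y * v a y * v b y) a b x := by
  have hD : ∀ a b : d, Torus.IsSmooth (fun y => if a = b then lam y else 0) := by
    intro a b
    by_cases h : a = b
    · simp only [h, if_true]; exact hlam
    · simp only [h, if_false]; exact Torus.isSmooth_const _
  have hR : ∀ a b, Torus.IsSmooth (fun y => 3 * (lam y * v a y * v b y)) := fun a b =>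
    (Torus.isSmooth_const _).mul ((hlam.mul (hv a)).mul (hv b))
  have hR' : ∀ a b, Torus.IsSmooth (fun y => lam y * v a y * v b y) := fun a b =>
    (hlam.mul (hv a)).mul (hv b)
  have hfun : (fun a b y => lam y * ((if a = b then (1 : ℝ) else 0) - 3 * v a y * v b y)) =
      fun a b y => (if a = b then lam y else 0) - 3 * (lam y * v a y * v b y) := by
    funext a b y
    by_cases h : a = b
    · simp only [h, if_true]; ring
    · simp only [h, if_false]; ring
  rw [hfun, Torus.strainProjection_sub hD hR, Torus.strainProjection_diagonal hlam,
    Torus.strainProjection_const_mul hR']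
  ring

/-- **Miller–Sawyer Prop 3.7 (rank-one reduction), torus form.** Printed (`ℝ³`):
`sup {‖P_{st}(λ(I₃ − 3v⊗v)/√6)‖²_{L²} : ‖λ‖_{L²} = 1, λ ≥ 0, |v(x)| = 1}
 = (3/2) sup {‖P_{st}(w⊗w)‖²_{L²} : ‖w‖_{L⁴} = 1}`, proved by the substitution `w = √λ v`
(`‖w‖⁴_{L⁴} = ‖λ‖²_{L²}`, `P_{st}(λ(I₃ − 3v⊗v)/√6) = −(3/√6)P_{st}(w⊗w)`). On `T^d` (any finite
nonempty `d`), smooth setting, the identity that makes the two suprema run over the same values: for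
every smooth vector field `w` (components `w_a`), with `|w|² = ∑_c w_c²` — so that
`λ(I − 3v⊗v) = |w|²I − 3w⊗w` for `λ = |w|²`, `v = w/|w|` —
`∫ ∑_{ab} (P_{st}((|w|²I − 3w⊗w)/√6))_{ab}² = (3/2) ∫ ∑_{ab} (P_{st}(w⊗w))_{ab}²`.
(The suprema over `L²`/`L⁴` classes are not formed here.) [cite: MillerSawyer2023, Prop 3.7 with proof] -/
theorem _root_.Literature.Analysis.FluidPDE.Torus.integral_sum_strainProjection_normSq_id_sub_three_outer_sq_eq
    [Nonempty d] {w : d → UnitAddTorus d → ℝ} (hw : ∀ a, Torus.IsSmooth (w a)) :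
    ∫ x, ∑ a, ∑ b, Torus.strainProjection
        (fun a b y => ((∑ c, w c y ^ 2) * (if a = b then (1 : ℝ) else 0) - 3 * w a y * w b y) /
          Real.sqrt 6) a b x ^ 2 =
      3 / 2 * ∫ x, ∑ a, ∑ b, Torus.strainProjection (fun a b y => w a y * w b y) a b x ^ 2 := by
  have hN : Torus.IsSmooth (fun y => ∑ c, w c y ^ 2) :=
    Torus.isSmooth_fun_finset_sum _ (g := fun c y => w c y ^ 2) fun c _ => (hw c).pow 2
  have hD : ∀ a b : d, Torus.IsSmooth (fun y => if a = b then (∑ c, w c y ^ 2) else 0) := by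
    intro a b
    by_cases h : a = b
    · simp only [h, if_true]; exact hN
    · simp only [h, if_false]; exact Torus.isSmooth_const _
  have hR : ∀ a b, Torus.IsSmooth (fun y => 3 * (w a y * w b y)) := fun a b =>
    (Torus.isSmooth_const _).mul ((hw a).mul (hw b))
  have hR' : ∀ a b, Torus.IsSmooth (fun y => w a y * w b y) := fun a b => (hw a).mul (hw b)
  have hS : ∀ a b, Torus.IsSmooth
      (fun y => (if a = b then (∑ c, w c y ^ 2) else 0) - 3 * (w a y * w b y)) := fun a b =>
    (hD a b).sub (hR a b)
  have h6 : (0 : ℝ) < Real.sqrt 6 := Real.sqrt_pos.mpr (by norm_num)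
  have hfun : (fun a b y => ((∑ c, w c y ^ 2) * (if a = b then (1 : ℝ) else 0) - 3 * w a y * w b y) /
        Real.sqrt 6) =
      fun a b y => (Real.sqrt 6)⁻¹ *
        ((if a = b then (∑ c, w c y ^ 2) else 0) - 3 * (w a y * w b y)) := by
    funext a b y
    by_cases h : a = b
    · simp only [h, if_true]; ring
    · simp only [h, if_false]; ring
  have hpt : ∀ a b x, Torus.strainProjection
      (fun a b y => ((∑ c, w c y ^ 2) * (if a = b then (1 : ℝ) else 0) - 3 * w a y * w b y) /
        Real.sqrt 6) a b x =
      -(3 / Real.sqrt 6) * Torus.strainProjection (fun a b y => w a y * w b y) a b x := by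
    intro a b x
    rw [hfun, Torus.strainProjection_const_mul hS, Torus.strainProjection_sub hD hR,
      Torus.strainProjection_diagonal hN, Torus.strainProjection_const_mul hR']
    field_simp
    ring
  simp_rw [hpt, mul_pow, ← Finset.mul_sum]
  rw [integral_const_mul]
  congr 1
  rw [neg_sq, div_pow, Real.sq_sqrt (by norm_num : (0 : ℝ) ≤ 6)]
  norm_num

end SymmetricHelmholtz

end Literature.Analysis.FluidPDE
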